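import Summits.KontsevichZagierPeriods.KontsevichZagierPeriods.Theses.FurushoPentagon
import Summits.KontsevichZagierPeriods.KontsevichZagierPeriods.Theses.CoactionDevissage
import Summits.KontsevichZagierPeriods.KontsevichZagierPeriods.Theses.Deregularisation
import Literature.NumberTheory.Transcendental.KZKernelConjectureForms
import Literature.NumberTheory.Transcendental.KZRulesAssociator
import Literature.NumberTheory.Transcendental.MultipleZetaHoffmanRelation
import Literature.NumberTheory.Transcendental.MultipleZetaDepthTwoProofs
import Literature.NumberTheory.Transcendental.MZVDualIndex
import Literature.NumberTheory.Transcendental.KZLogCalculusProofs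

/-!
# Disproof of `HoffmanRelationInKZ` (crux stmt-KontsevichZagierPeriods-3930) — findings

Standing adversary file of the crux disprover (route FurushoPentagon, rank-4 crux; TWIN of
CoactionDevissage's `HoffmanRegularisation`, stmt-3167, `iff_hoffmanRegularisation`). Everything below
is `sorry`-free; prose only in docstrings. Generation 2 (2026-08-15) rebuilds and extends generation 1's
v1–v3 (whose text is not mounted on this hub; their theorems are re-proved here under new names).
Generation 3 (2026-08-16) adds §8: the picked line's stubs as TARGETS (one of them, `stub_shuffleWords`,
proved outright; the six analytic ones certified evaluatively exact), and the level-1 / level-2 linear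
algebra locating the family relative to the route's other items (§8b).

**VERDICT SO FAR: NO KILL, and none is possible short of refuting Conjecture 1 itself.**

## Index

* §0 objects: `hoffmanElement Z s` (= the crux's element), `Pinned Z`, canonical `zetaRep` (`ρ`);
  `hoffmanRelationInKZ_iff` (unfolding), `hoffman_iff_canonical` (the `∀ Z`-device collapses: every
  surgery index is admissible, `isAdmissible_raise` / `isAdmissible_split` — no junk-`Z` escape).
* §1 WHY IT RESISTS: `eval_hoffmanElement_eq_zero` — the value of Hoffman's element is `0` for every
  pinned `Z` and admissible `s` (Hoffman 1992 Thm 5.1 and Kontsevich's formula are tree theorems), so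
  soundness forbids any evaluative refutation; `of_kernel` / `of_summit` / `not_summit_of_not`: the
  summit implies the crux, a kill here kills `KontsevichZagierPeriods`; `counterexample_shape`: a
  refutation is an element of `ker eval ∖ relations`; `of_nsmul_mem`: no torsion escape given the
  provable support item `IntegerDivision`; `iff_hoffmanRegularisation`: twin.
* §2 LOAD-BEARING hypotheses (families of witnesses, arithmetic not junk): `false_without_pinning`;
  `false_at_head_one` (every `s = (1, t)`: the `ζ(1)` corner, uniformly in `t`),
  `false_without_admissibility`; `hoffmanElement_zetaRep_zero_cons` (head `0` is harmless: `H = 0`);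
  `false_at_interior_zero` (every `s = (a, 0, t)`); `mirror_false_at_two` (the increasing-convention
  placement `(…, j+1, s_i − j, …)` is NOT a relation family here — convention certified).
* §3 MOVE BUDGET (sub-calculus invariants): `coeffSum_hoffmanElement` (`ε(H(s)) = 2k − w`),
  `not_mem_covNL` (**additivity is needed whenever `w ≠ 2k`**, all odd weights, `s = (3)`);
  `addOnly_le_ker_windowEval` + `two_not_mem_addOnly` / `three_not_mem_addOnly` (**a change of
  variables or a Newton–Leibniz move is needed already for Euler's `s = (2)` and for `s = (3)`**).
  `noStokes_locality` (§3c: the Stokes-free sub-calculus is dimension-graded, so **a Newton–Leibniz-free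
  proof of Hoffman(s) uses no auxiliary variable** — a chain among `(w+1)`-dimensional representations).
  OPEN (documented, not decided): is Newton–Leibniz itself necessary for `s = (3)`? No invariant of
  `closure(1a ∪ 1b ∪ 2)` separating `H(3)` is known; by locality the question is one about
  4-dimensional scissors-and-substitution chains.
* §4 STRENGTHENINGS refuted: `not_hoffmanTermwise` (+ `termwise_false_at_two_one_zero`),
  `hoffmanElement_two_ne_zero` (not a syntactic identity).
* §5 CHEAP INSTANCES: `instance_nil`; `atTwo_iff` (Euler = `KZ.Equivalent` of the two simplices),
  `atTwo_of_duality`, `atThreeOne_of_duality`, `atTwoTwo_of_duality` (from `DualityInKZ` alone);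
  `hoffmanElement_three` + `eval_hoffmanElement_three` (first live instance).
* §7 CROSS-ROUTE: `atThree_iff_hoffmanWeightFour` — the `s = (3)` instance IS Deregularisation's
  `HoffmanWeightFour` (stmt-3906); with the twin 3167 and §6 the weight-4 relation is reached from
  three routes and two directions.
* §8 TARGETS (gen 3): the picked line `dilation-homotopy-transposition` — `stub_shuffleWords_holds`
  (the combinatorial stub, PROVED for all admissible `s` via `gapWords_perm`; kernel-checked to weight 10),
  a rule-shape audit of the six analytic stubs (all evaluatively exact: `value(B_s) = Σ H_{n₁}/n^s`,
  `∂_λ[λf_s(σ_λx)] = K_s(σ_λx)`; no kill), and §8b: modulo the route's OTHER items the family through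
  weight 11 is generated by `H(3)` alone (exact linear algebra per weight), depth one is NOT a reduction,
  and the level-2 transfer `C⁺` PASSES at `W = 9` (corank 55 = F₁₀, 64/64 Hoffman; kit j007813, §8c) with DS
  factors of weight ≥ 3 redundant; `W = 10` pending (kit j007814).
* §6 `ℤ/2`-SYMMETRY: `splits(s) = τ(raises(τ s))` (`splits_perm_le_eight` / `splits_perm_le_ten`,
  kernel-checked for the 512 admissible indices of weight `≤ 10`; exact enumeration to weight 12); hence modulo `DualityInKZ`
  `H(s) ≡ R(s) − R(τ s)` (`hoffman_sub_raiseDefect_mem`), `Hoffman(s) ⟺ Hoffman(τ s)`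
  (`hoffman_iff_hoffman_dual`), and the self-dual indices (16 of weight `≤ 8`, `selfDual_le_eight`) are
  exactly the CoV-only instances (`selfDual_le_eight_of_duality`).

## Prover briefing (what a proof must look like)
First target `s = (3)` — and, per weight through weight 11, the ONLY target not implied by the route's
other items (§8b): `[ζ-rep 4] − [ζ-rep(3,1)] − [ζ-rep(2,2)] ∈ relations`; any chain uses an
additivity move AND a change of variables / Newton–Leibniz move (§3); modulo duality it is the
raise-symmetry `R(3) ~ R(2,1)` (§6). Every head-`1` extension by zero is false (§2b): the `ζ(1)` corner
must be crossed with convergent intermediates or an extra variable, never by setting divergent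
classes to `0`.
-/

noncomputable section

set_option linter.dupNamespace false

namespace Summit.KontsevichZagierPeriods.KontsevichZagierPeriods.Cruxes.HoffmanRelationInKZ.Disproof

open MeasureTheory Set
open Literature.NumberTheory.Transcendental
open Literature.NumberTheory.Transcendental.KZ
open Summit.KontsevichZagierPeriods.KontsevichZagierPeriods.Theses.FurushoPentagon

/-! ## §0 The objects: Hoffman's element, pinned assignments, the canonical assignment -/

/-- The simplex representation `[Δ^w, ω_{ε(s)}]` of `ζ(s)` with the tree's two analytic inputs fed
(the literal sub-term of the crux). -/
abbrev zRep (u : List ℕ) (hu : MZV.IsAdmissible u) : IntegralRep (MZV.weight u) :=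
  mzvRep u hu (mzvIntegrand_isSemialgebraicFunOn_holds u) (mzvIntegrand_integrableOn_holds u hu)

/-- The raised index `(s₁,…,s_i + 1,…,s_k)` (0-based position `i`), in the crux's
`take/getD/drop` spelling. -/
def raise (s : List ℕ) (i : ℕ) : List ℕ := s.take i ++ [s.getD i 0 + 1] ++ s.drop (i + 1)

/-- The split index `(s₁,…,s_{i-1}, s_i − j, j + 1, s_{i+1},…,s_k)`, in the crux's spelling. -/
def split (s : List ℕ) (i j : ℕ) : List ℕ := s.take i ++ [s.getD i 0 - j, j + 1] ++ s.drop (i + 1)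

/-- **Hoffman's element** `H_Z(s) = Σ_i Z(raise s i) − Σ_i Σ_{j ≤ s_i − 2} Z(split s i j)`, literally the
left-hand side of the crux's membership statement. -/
def hoffmanElement (Z : List ℕ → FormalRep) (s : List ℕ) : FormalRep :=
  ((List.range s.length).map (fun i => Z (s.take i ++ [s.getD i 0 + 1] ++ s.drop (i + 1)))).sum -
  ((List.range s.length).map (fun i => ((List.range (s.getD i 0 - 1)).map
    (fun j => Z (s.take i ++ [s.getD i 0 - j, j + 1] ++ s.drop (i + 1)))).sum)).sum

/-- `hoffmanElement` through `raise`/`split`. -/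
theorem hoffmanElement_eq (Z : List ℕ → FormalRep) (s : List ℕ) :
    hoffmanElement Z s = ((List.range s.length).map (fun i => Z (raise s i))).sum -
      ((List.range s.length).map (fun i => ((List.range (s.getD i 0 - 1)).map
        (fun j => Z (split s i j))).sum)).sum := rfl

/-- An assignment `Z : List ℕ → FormalRep` is *pinned* if it agrees with the simplex classes on
admissible indices (the crux's only hypothesis on `Z`). -/
def Pinned (Z : List ℕ → FormalRep) : Prop :=
  ∀ (u : List ℕ) (hu : MZV.IsAdmissible u), Z u = of (zRep u hu)

/-- **The crux, unfolded**: for every pinned `Z` and admissible `s`, `H_Z(s) ∈ relations`. -/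
theorem hoffmanRelationInKZ_iff :
    HoffmanRelationInKZ ↔ ∀ Z, Pinned Z → ∀ s, MZV.IsAdmissible s → hoffmanElement Z s ∈ relations :=
  Iff.rfl

/-- The canonical assignment `ρ(u) = [ζ-rep u]` on admissible `u`, `0` elsewhere (the `ρ` of route
CoactionDevissage). -/
def zetaRep (u : List ℕ) : FormalRep :=
  if h : MZV.IsAdmissible u then of (zRep u h) else 0

/-- `ρ(u) = [ζ-rep u]` on admissible `u`. [folklore] -/
theorem zetaRep_of_isAdmissible {u : List ℕ} (hu : MZV.IsAdmissible u) : zetaRep u = of (zRep u hu) := by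
  simp [zetaRep, hu]

/-- `ρ(u) = 0` off admissible indices. [folklore] -/
theorem zetaRep_of_not_isAdmissible {u : List ℕ} (hu : ¬ MZV.IsAdmissible u) : zetaRep u = 0 := by
  simp [zetaRep, hu]

/-- The canonical assignment is pinned (so the crux's hypothesis is satisfiable: no vacuity). -/
theorem pinned_zetaRep : Pinned zetaRep := fun _ hu => zetaRep_of_isAdmissible hu

/-- `eval` of the canonical assignment is the multiple zeta value on admissible indices
(Kontsevich's formula, `KZ.mzvRep_value_holds`). -/
theorem eval_zetaRep {u : List ℕ} (hu : MZV.IsAdmissible u) : eval (zetaRep u) = multipleZeta u := by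
  rw [zetaRep_of_isAdmissible hu, eval_of]
  exact mzvRep_value_holds u hu _ _

/-- A pinned assignment evaluates to the multiple zeta values (Kontsevich's formula). [folklore] -/
theorem eval_of_pinned {Z : List ℕ → FormalRep} (hZ : Pinned Z) {u : List ℕ} (hu : MZV.IsAdmissible u) :
    eval (Z u) = multipleZeta u := by
  rw [hZ u hu, eval_of]
  exact mzvRep_value_holds u hu _ _

/-! ### Admissibility of the surgery indices (no junk-`Z` escape) -/

/-- `s.getD i 0 = s[i]` in range. [folklore] -/
theorem getD_eq_getElem {s : List ℕ} {i : ℕ} (hi : i < s.length) : s.getD i 0 = s[i] := by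
  rw [List.getD_eq_getElem?_getD, List.getElem?_eq_getElem hi, Option.getD_some]

/-- Entries of an admissible index are positive. [folklore] -/
theorem one_le_getElem_of_isAdmissible {s : List ℕ} (hs : MZV.IsAdmissible s) {i : ℕ}
    (hi : i < s.length) : 1 ≤ s[i] :=
  hs.1 _ (List.getElem_mem hi)

/-- Raising position `0`. [folklore] -/
@[simp] theorem raise_cons_zero (a : ℕ) (t : List ℕ) : raise (a :: t) 0 = (a + 1) :: t := by
  simp [raise]

/-- Raising a later position commutes with `cons`. [folklore] -/
@[simp] theorem raise_cons_succ (a : ℕ) (t : List ℕ) (i : ℕ) :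
    raise (a :: t) (i + 1) = a :: raise t i := by
  simp [raise]

/-- Splitting position `0`. [folklore] -/
@[simp] theorem split_cons_zero (a : ℕ) (t : List ℕ) (j : ℕ) :
    split (a :: t) 0 j = (a - j) :: (j + 1) :: t := by
  simp [split]

/-- Splitting a later position commutes with `cons`. [folklore] -/
@[simp] theorem split_cons_succ (a : ℕ) (t : List ℕ) (i j : ℕ) :
    split (a :: t) (i + 1) j = a :: split t i j := by
  simp [split]

/-- Raising an entry keeps all entries positive. -/
theorem forall_one_le_raise {t : List ℕ} (ht : ∀ x ∈ t, 1 ≤ x) (i : ℕ) : ∀ x ∈ raise t i, 1 ≤ x := by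
  intro x hx
  simp only [raise, List.mem_append, List.mem_singleton] at hx
  rcases hx with (hx | rfl) | hx
  · exact ht x (List.mem_of_mem_take hx)
  · omega
  · exact ht x (List.mem_of_mem_drop hx)

/-- Splitting an entry `s_i` at `j < s_i − 1` keeps all entries positive. -/
theorem forall_one_le_split {t : List ℕ} (ht : ∀ x ∈ t, 1 ≤ x) {i j : ℕ} (hj : j < t.getD i 0 - 1) :
    ∀ x ∈ split t i j, 1 ≤ x := by
  intro x hx
  simp only [split, List.mem_append, List.mem_cons, List.not_mem_nil, or_false] at hx
  rcases hx with (hx | rfl | rfl) | hx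
  · exact ht x (List.mem_of_mem_take hx)
  · omega
  · omega
  · exact ht x (List.mem_of_mem_drop hx)

/-- Raised indices of a (nonempty) admissible index are admissible. -/
theorem isAdmissible_raise {s : List ℕ} (hs : MZV.IsAdmissible s) {i : ℕ} (hi : i < s.length) :
    MZV.IsAdmissible (raise s i) := by
  cases s with
  | nil => simp at hi
  | cons a t =>
    rw [MZV.isAdmissible_cons_iff] at hs
    cases i with
    | zero =>
      rw [raise_cons_zero, MZV.isAdmissible_cons_iff]
      exact ⟨by omega, hs.2⟩
    | succ i =>
      rw [raise_cons_succ, MZV.isAdmissible_cons_iff]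
      exact ⟨hs.1, forall_one_le_raise hs.2 i⟩

/-- Split indices of an admissible index are admissible (`j ≤ s_i − 2` keeps `s_i − j ≥ 2`). -/
theorem isAdmissible_split {s : List ℕ} (hs : MZV.IsAdmissible s) {i : ℕ} (hi : i < s.length) {j : ℕ}
    (hj : j < s.getD i 0 - 1) : MZV.IsAdmissible (split s i j) := by
  cases s with
  | nil => simp at hi
  | cons a t =>
    rw [MZV.isAdmissible_cons_iff] at hs
    cases i with
    | zero =>
      simp only [List.getD_cons_zero] at hj
      rw [split_cons_zero, MZV.isAdmissible_cons_iff]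
      refine ⟨by omega, ?_⟩
      intro x hx
      rcases List.mem_cons.mp hx with rfl | hx
      · omega
      · exact hs.2 x hx
    | succ i =>
      simp only [List.getD_cons_succ] at hj
      rw [split_cons_succ, MZV.isAdmissible_cons_iff]
      exact ⟨hs.1, forall_one_le_split hs.2 hj⟩

/-- Two assignments agreeing on admissible indices have the same Hoffman element at admissible `s`. -/
theorem hoffmanElement_congr {Z Z' : List ℕ → FormalRep} (h : ∀ u, MZV.IsAdmissible u → Z u = Z' u)
    {s : List ℕ} (hs : MZV.IsAdmissible s) : hoffmanElement Z s = hoffmanElement Z' s := by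
  rw [hoffmanElement_eq, hoffmanElement_eq]
  congr 1
  · congr 1
    refine List.map_congr_left fun i hi => ?_
    exact h _ (isAdmissible_raise hs (List.mem_range.mp hi))
  · congr 1
    refine List.map_congr_left fun i hi => ?_
    congr 1
    refine List.map_congr_left fun j hj => ?_
    exact h _ (isAdmissible_split hs (List.mem_range.mp hi) (List.mem_range.mp hj))

/-- A pinned assignment has the canonical Hoffman elements. -/
theorem hoffmanElement_eq_of_pinned {Z : List ℕ → FormalRep} (hZ : Pinned Z) {s : List ℕ}
    (hs : MZV.IsAdmissible s) : hoffmanElement Z s = hoffmanElement zetaRep s :=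
  hoffmanElement_congr (fun u hu => by rw [hZ u hu, zetaRep_of_isAdmissible hu]) hs

/-- **The `∀ Z`-device collapses**: the crux is the statement about the canonical classes. -/
theorem hoffman_iff_canonical :
    HoffmanRelationInKZ ↔ ∀ s, MZV.IsAdmissible s → hoffmanElement zetaRep s ∈ relations := by
  rw [hoffmanRelationInKZ_iff]
  constructor
  · intro h s hs
    exact h zetaRep pinned_zetaRep s hs
  · intro h Z hZ s hs
    rw [hoffmanElement_eq_of_pinned hZ hs]
    exact h s hs


/-! ### Small instances, unfolded -/

/-- `s = ()`: the element is `0` (trivially a relation). [folklore] -/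
theorem hoffmanElement_nil (Z : List ℕ → FormalRep) : hoffmanElement Z [] = 0 := by
  simp [hoffmanElement]

/-- `s = (2)`: `Z(3) − Z(2,1)` (Euler's `ζ(3) = ζ(2,1)`). [folklore] -/
theorem hoffmanElement_two (Z : List ℕ → FormalRep) : hoffmanElement Z [2] = Z [3] - Z [2, 1] := by
  simp [hoffmanElement]

/-- `s = (3)`: `Z(4) − (Z(3,1) + Z(2,2))` — the first instance that is NOT a sum of duality pairs
(`(3,1)`, `(2,2)` are self-dual, `τ(4) = (2,1,1)`); twin of Deregularisation's `HoffmanWeightFour`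
(stmt-3906, §7) and the recommended first prover target. [folklore] -/
theorem hoffmanElement_three (Z : List ℕ → FormalRep) :
    hoffmanElement Z [3] = Z [4] - (Z [3, 1] + Z [2, 2]) := by
  simp [hoffmanElement, List.range_succ]

/-- `s = (2,1)`: `(Z(3,1) + Z(2,2)) − Z(2,1,1)`. [folklore] -/
theorem hoffmanElement_two_one (Z : List ℕ → FormalRep) :
    hoffmanElement Z [2, 1] = Z [3, 1] + Z [2, 2] - Z [2, 1, 1] := by
  simp [hoffmanElement, List.range_succ]

/-! ## §1 Logical position: the value identity is a tree theorem, so the crux is summit-implied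

`eval H_Z(s) = Σ_l ζ(raise) − Σ_l Σ_j ζ(split) = 0` is Hoffman 1992 Thm 5.1, PROVED in the tree
(`multipleZeta_hoffman_relation`) once the crux's `List.range/getD` sums are converted to the fact's
`Fin/get` sums; with Kontsevich's formula (`mzvRep_value_holds`, proved) every pinned `Z` evaluates to
the MZVs. Hence the kernel conjecture — equivalently the summit — implies the crux, and a refutation
of the crux is a refutation of Conjecture 1: the separating invariant would have to be NON-evaluative. -/

/-- `((List.range n).map f).sum` as a `Finset.range` sum. [folklore] -/
theorem list_sum_range_map_finset {M : Type*} [AddCommMonoid M] (n : ℕ) (f : ℕ → M) :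
    ((List.range n).map f).sum = ∑ i ∈ Finset.range n, f i := by
  induction n with
  | zero => simp
  | succ n ih =>
    rw [List.range_succ, List.map_append, List.sum_append, ih, Finset.sum_range_succ]
    simp

/-- `((List.range n).map f).sum` as a sum over `Fin n`. [folklore] -/
theorem list_sum_range_map_fin {M : Type*} [AddCommMonoid M] (n : ℕ) (f : ℕ → M) :
    ((List.range n).map f).sum = ∑ i : Fin n, f i := by
  rw [list_sum_range_map_finset, Finset.sum_range]

/-- `s.getD l 0 = s.get l` for `l : Fin s.length`. [folklore] -/
theorem getD_fin (s : List ℕ) (l : Fin s.length) : s.getD l 0 = s.get l := by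
  rw [getD_eq_getElem l.2, List.get_eq_getElem]

/-- **Hoffman's element in the `Fin/get` indexing** of the tree fact `hoffman_relation` and of the twin
crux `CoactionDevissage.HoffmanRegularisation`. -/
theorem hoffmanElement_eq_finSum (Z : List ℕ → FormalRep) (s : List ℕ) :
    hoffmanElement Z s =
      (∑ l : Fin s.length, Z (s.take l.1 ++ [s.get l + 1] ++ s.drop (l.1 + 1))) -
        ∑ l : Fin s.length, ∑ j ∈ Finset.range (s.get l - 1),
          Z (s.take l.1 ++ [s.get l - j, j + 1] ++ s.drop (l.1 + 1)) := by
  unfold hoffmanElement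
  rw [list_sum_range_map_fin, list_sum_range_map_fin]
  congr 1
  · refine Finset.sum_congr rfl fun l _ => ?_
    rw [getD_fin]
  · refine Finset.sum_congr rfl fun l _ => ?_
    rw [list_sum_range_map_finset, getD_fin]

/-- **The value of Hoffman's element** for a pinned assignment is the two sides of Hoffman's printed
relation. [cite: Hoffman1992, Theorem 5.1] -/
theorem eval_hoffmanElement {Z : List ℕ → FormalRep} (hZ : Pinned Z) {s : List ℕ}
    (hs : MZV.IsAdmissible s) :
    eval (hoffmanElement Z s) =
      (∑ l : Fin s.length, multipleZeta (s.take l.1 ++ [s.get l + 1] ++ s.drop (l.1 + 1))) -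
        ∑ l : Fin s.length, ∑ j ∈ Finset.range (s.get l - 1),
          multipleZeta (s.take l.1 ++ [s.get l - j, j + 1] ++ s.drop (l.1 + 1)) := by
  rw [hoffmanElement_eq_finSum, map_sub, map_sum, map_sum]
  congr 1
  · refine Finset.sum_congr rfl fun l _ => ?_
    have h := isAdmissible_raise hs l.2
    rw [raise, getD_fin] at h
    exact eval_of_pinned hZ h
  · refine Finset.sum_congr rfl fun l _ => ?_
    rw [map_sum]
    refine Finset.sum_congr rfl fun j hj => ?_
    have h := isAdmissible_split hs l.2 (j := j) (by rw [getD_fin]; exact Finset.mem_range.mp hj)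
    rw [split, getD_fin] at h
    exact eval_of_pinned hZ h

/-- **`eval H_Z(s) = 0`** (Hoffman 1992 Thm 5.1, tree theorem `multipleZeta_hoffman_relation`):
no EVALUATIVE refutation of the crux exists. [cite: Hoffman1992, Theorem 5.1] -/
theorem eval_hoffmanElement_eq_zero {Z : List ℕ → FormalRep} (hZ : Pinned Z) {s : List ℕ}
    (hs : MZV.IsAdmissible s) : eval (hoffmanElement Z s) = 0 := by
  rw [eval_hoffmanElement hZ hs, multipleZeta_hoffman_relation hs, sub_self]

/-- **Kernel conjecture ⇒ crux.** [folklore] -/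
theorem of_kernel (hK : KZKernelConjecture) : HoffmanRelationInKZ :=
  fun _ hZ _ hs => hK _ (eval_hoffmanElement_eq_zero hZ hs)

/-- The kernel FORM written out (the conclusion of the route's `SectorToKernel`) ⇒ crux. [folklore] -/
theorem of_kernelForm (hK : ∀ c : FormalRep, eval c = 0 → c ∈ relations) : HoffmanRelationInKZ :=
  of_kernel hK

/-- **Summit ⇒ crux** (`kzKernelConjecture_iff_isRational`, `KontsevichZagierPeriods_iff`). [folklore] -/
theorem of_summit (h : KontsevichZagierPeriods) : HoffmanRelationInKZ :=
  of_kernel (kzKernelConjecture_iff_isRational.mpr (KontsevichZagierPeriods_iff.mp h))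

/-- **A kill of this crux is a kill of the summit.** [folklore] -/
theorem not_summit_of_not (h : ¬ HoffmanRelationInKZ) : ¬ KontsevichZagierPeriods :=
  fun hs => h (of_summit hs)

/-- **Shape of any counterexample**: a refutation exhibits an admissible `s` whose canonical Hoffman
element is a non-relation of value `0` — an element of `ker eval ∖ relations`. [folklore] -/
theorem counterexample_shape (h : ¬ HoffmanRelationInKZ) :
    ∃ s, MZV.IsAdmissible s ∧ eval (hoffmanElement zetaRep s) = 0 ∧
      hoffmanElement zetaRep s ∉ relations := by
  rw [hoffman_iff_canonical] at h
  push Not at h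
  obtain ⟨s, hs, hns⟩ := h
  exact ⟨s, hs, eval_hoffmanElement_eq_zero pinned_zetaRep hs, hns⟩

/-- **No torsion escape.** The route's lever produces Hoffman's element in `relations` only after
tensoring with `ℚ` (Furusho's theorem runs over the ℚ-algebra `P_ℚ`), i.e. `N • H(s) ∈ relations` for
some `N > 0`; a conceivable failure mode of the INTEGRAL crux with the rational statement intact would be
a torsion class `H(s)` of `P = FormalRep ⧸ relations`. The route's support item `IntegerDivision`
(stmt-3934, provable now: the scaling endomorphism `[σ, f] ↦ [σ, f/N]` preserves the four move sets and
`c − N • S_N c ∈ relations` by integrand additivity) closes this escape. [folklore] -/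
theorem of_nsmul_mem (hID : IntegerDivision) {Z : List ℕ → FormalRep} {s : List ℕ} {N : ℕ} (hN : 0 < N)
    (h : N • hoffmanElement Z s ∈ relations) : hoffmanElement Z s ∈ relations :=
  hID _ N hN h

/-- **TWIN**: the crux is the same statement as route CoactionDevissage's crux `HoffmanRegularisation`
(stmt-KontsevichZagierPeriods-3167): the `∀ Z`-device collapses to the canonical `ρ` and the
`List.range/getD` sums are the `Fin/get` sums. A proof or refutation of either closes both. [folklore] -/
theorem iff_hoffmanRegularisation :
    HoffmanRelationInKZ ↔ Theses.CoactionDevissage.HoffmanRegularisation := by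
  rw [hoffman_iff_canonical]
  unfold Theses.CoactionDevissage.HoffmanRegularisation
  simp only [hoffmanElement_eq_finSum]
  exact Iff.rfl


/-! ## §2 Load-bearing analysis: every hypothesis is used by any proof

The crux has two hypotheses — `Z` pinned on admissible indices, `s` admissible (= all entries `≥ 1`
AND head `≥ 2`) — and one hidden convention (Hoffman's placement `(…, s_i − j, j + 1, …)` of the
decreasing-sum convention). Each is load-bearing, uniformly (whole families of witnesses, not one): -/

/-- The basic non-relation: **`[ζ-rep u] ∉ relations`** for admissible `u` — it evaluates to
`ζ(u) > 0` (`multipleZeta_pos_of_isAdmissible_holds`) and relations evaluate to `0` (soundness). -/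
theorem of_zRep_not_mem_relations {u : List ℕ} (hu : MZV.IsAdmissible u) : of (zRep u hu) ∉ relations := by
  intro h
  have h0 : eval (of (zRep u hu)) = 0 := relations_le_ker_eval_holds h
  rw [eval_of, mzvRep_value_holds] at h0
  exact (multipleZeta_pos_of_isAdmissible_holds hu).ne' h0

/-- `ρ(u) ∉ relations` for admissible `u`. [folklore] -/
theorem zetaRep_not_mem_relations {u : List ℕ} (hu : MZV.IsAdmissible u) : zetaRep u ∉ relations := by
  rw [zetaRep_of_isAdmissible hu]; exact of_zRep_not_mem_relations hu

/-! ### (a) Drop the pinning of `Z` -/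

/-- The crux with the pinning hypothesis dropped. -/
def WithoutPinning : Prop :=
  ∀ (Z : List ℕ → FormalRep) (s : List ℕ), MZV.IsAdmissible s → hoffmanElement Z s ∈ relations

/-- **Any proof must use the pinning**: with `Z(3) := [ζ-rep(3)]`, `Z := 0` elsewhere, the element at
`s = (2)` is `[ζ-rep(3)] ∉ relations`. [folklore] -/
theorem false_without_pinning : ¬ WithoutPinning := by
  intro h
  have h3 : MZV.IsAdmissible [3] := by decide
  have := h (fun u => if u = [3] then of (zRep [3] h3) else 0) [2] (by decide)
  rw [hoffmanElement_two] at this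
  simp only [if_true, List.cons.injEq, if_neg (show ¬ (2 = 3 ∧ [1] = ([] : List ℕ)) by simp)] at this
  simp at this
  exact of_zRep_not_mem_relations h3 this

/-! ### (b) Drop admissibility of `s` — with the CANONICAL classes (`ρ = 0` off admissible indices,
i.e. "divergent ζ's regularised to 0"), so that no junk-`Z` is involved: the failure is arithmetic. -/

/-- The crux for the canonical classes with admissibility of `s` dropped. -/
def WithoutAdmissibility : Prop :=
  ∀ s : List ℕ, hoffmanElement zetaRep s ∈ relations

/-- A sum of zeros over a list. [folklore] -/
theorem list_sum_map_eq_zero {α M : Type*} [AddCommMonoid M] (l : List α) (f : α → M)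
    (h : ∀ x ∈ l, f x = 0) : (l.map f).sum = 0 := by
  rw [List.map_congr_left h]; simp

/-- **Head `1` (the `ζ(1)` corner)**: for `s = (1, t)` every raised or split index except `(2, t)` has
head `1`, so `H_ρ(1, t) = ρ(2, t)`. -/
theorem hoffmanElement_zetaRep_one_cons (t : List ℕ) :
    hoffmanElement zetaRep (1 :: t) = zetaRep (2 :: t) := by
  have hna : ∀ u : List ℕ, ¬ MZV.IsAdmissible (1 :: u) := fun u h => by
    have := (MZV.isAdmissible_cons_iff.mp h).1; omega
  rw [hoffmanElement_eq]
  have h2 : ∀ i ∈ List.range (1 :: t).length,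
      ((List.range ((1 :: t).getD i 0 - 1)).map (fun j => zetaRep (split (1 :: t) i j))).sum = 0 := by
    intro i _
    cases i with
    | zero => simp
    | succ i =>
      refine list_sum_map_eq_zero _ _ fun j _ => ?_
      rw [split_cons_succ, zetaRep_of_not_isAdmissible (hna _)]
  rw [list_sum_map_eq_zero _ _ h2, sub_zero, List.length_cons, List.range_succ_eq_map, List.map_cons,
    List.sum_cons, raise_cons_zero, List.map_map]
  rw [list_sum_map_eq_zero _ _ fun i _ => ?_, add_zero]
  rw [Function.comp_apply, raise_cons_succ, zetaRep_of_not_isAdmissible (hna _)]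

/-- **Every head-`1` instance is false** (uniformly in the tail): Hoffman's formula at `s = (1, t)` would
put `[ζ-rep(2, t)]` (value `ζ(2, t) > 0`) in `relations`. So admissibility of `s` is load-bearing
through its HEAD condition, at every index — the `ζ(1)`-divergence is exactly where the printed
relation stops (its correct extension regularises, IKZ 2006 Thm 2 (v)). [folklore] -/
theorem false_at_head_one (t : List ℕ) (ht : ∀ x ∈ t, 1 ≤ x) :
    hoffmanElement zetaRep (1 :: t) ∉ relations := by
  rw [hoffmanElement_zetaRep_one_cons]
  exact zetaRep_not_mem_relations (MZV.isAdmissible_cons_iff.mpr ⟨le_rfl, ht⟩)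

/-- In particular `s = (1)`: "`ζ(2) ∈ relations`". -/
theorem false_without_admissibility : ¬ WithoutAdmissibility := fun h => false_at_head_one [] (by simp) (h _)

/-- **Head `0` is harmless** (every index produced has head `≤ 1`): `H_ρ(0, t) = 0`. So with the
canonical classes the head condition fails EXACTLY at head `1`. -/
theorem hoffmanElement_zetaRep_zero_cons (t : List ℕ) : hoffmanElement zetaRep (0 :: t) = 0 := by
  have hna0 : ∀ u : List ℕ, ¬ MZV.IsAdmissible (0 :: u) := fun u h => by
    have := (MZV.isAdmissible_cons_iff.mp h).1; omega
  have hna1 : ∀ u : List ℕ, ¬ MZV.IsAdmissible (1 :: u) := fun u h => by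
    have := (MZV.isAdmissible_cons_iff.mp h).1; omega
  rw [hoffmanElement_eq]
  have h2 : ∀ i ∈ List.range (0 :: t).length,
      ((List.range ((0 :: t).getD i 0 - 1)).map (fun j => zetaRep (split (0 :: t) i j))).sum = 0 := by
    intro i _
    cases i with
    | zero => simp
    | succ i =>
      refine list_sum_map_eq_zero _ _ fun j _ => ?_
      rw [split_cons_succ, zetaRep_of_not_isAdmissible (hna0 _)]
  rw [list_sum_map_eq_zero _ _ h2, sub_zero]
  refine list_sum_map_eq_zero _ _ fun i _ => ?_
  cases i with
  | zero => rw [raise_cons_zero, zetaRep_of_not_isAdmissible (hna1 _)]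
  | succ i => rw [raise_cons_succ, zetaRep_of_not_isAdmissible (hna0 _)]

/-- **Interior positivity is load-bearing too**: at `s = (a, 0, t)` (`a ≥ 2`, `t` positive) the only
surviving term is the raised index `(a, 1, t)`: `H_ρ(a, 0, t) = ρ(a, 1, t)`, of value `ζ(a,1,t) > 0`. -/
theorem hoffmanElement_zetaRep_cons_zero_cons (a : ℕ) (t : List ℕ) :
    hoffmanElement zetaRep (a :: 0 :: t) = zetaRep (a :: 1 :: t) := by
  have hna : ∀ (b : ℕ) (u : List ℕ), ¬ MZV.IsAdmissible (b :: 0 :: u) := fun b u h => by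
    have := (MZV.isAdmissible_cons_iff.mp h).2 0 (by simp); omega
  have hna' : ∀ (b c : ℕ) (u : List ℕ), ¬ MZV.IsAdmissible (b :: c :: 0 :: u) := fun b c u h => by
    have := (MZV.isAdmissible_cons_iff.mp h).2 0 (by simp); omega
  rw [hoffmanElement_eq]
  have h2 : ∀ i ∈ List.range (a :: 0 :: t).length,
      ((List.range ((a :: 0 :: t).getD i 0 - 1)).map (fun j => zetaRep (split (a :: 0 :: t) i j))).sum = 0 := by
    intro i _
    rcases i with _ | _ | i
    · refine list_sum_map_eq_zero _ _ fun j _ => ?_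
      rw [split_cons_zero, zetaRep_of_not_isAdmissible (hna' _ _ _)]
    · simp
    · refine list_sum_map_eq_zero _ _ fun j _ => ?_
      rw [split_cons_succ, split_cons_succ, zetaRep_of_not_isAdmissible (hna _ _)]
  rw [list_sum_map_eq_zero _ _ h2, sub_zero]
  rw [List.length_cons, List.length_cons, List.range_succ_eq_map, List.map_cons, List.sum_cons,
    raise_cons_zero, zetaRep_of_not_isAdmissible (hna _ _), zero_add, List.range_succ_eq_map,
    List.map_cons, List.map_cons, List.sum_cons, List.map_map, List.map_map]
  rw [list_sum_map_eq_zero _ _ fun i _ => ?_, add_zero]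
  · simp [raise]
  · simp only [Function.comp_apply, raise_cons_succ]
    exact zetaRep_of_not_isAdmissible (hna _ _)

/-- **Every `(a, 0, t)` instance is false** (`a ≥ 2`, `t` positive). [folklore] -/
theorem false_at_interior_zero {a : ℕ} (ha : 2 ≤ a) (t : List ℕ) (ht : ∀ x ∈ t, 1 ≤ x) :
    hoffmanElement zetaRep (a :: 0 :: t) ∉ relations := by
  rw [hoffmanElement_zetaRep_cons_zero_cons]
  refine zetaRep_not_mem_relations (MZV.isAdmissible_cons_iff.mpr ⟨ha, ?_⟩)
  intro x hx
  rcases List.mem_cons.mp hx with rfl | hx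
  · exact le_rfl
  · exact ht x hx

/-! ### (c) The placement convention is load-bearing: the MIRROR family `(…, j + 1, s_i − j, …)`
(Hoffman's relation in the INCREASING-sum convention `n₁ < ⋯ < n_k`, last entry `≥ 2`) is not a
relation family for the tree's decreasing convention. -/

/-- Hoffman's element with the mirrored placement of the split block. -/
def hoffmanElementMirror (Z : List ℕ → FormalRep) (s : List ℕ) : FormalRep :=
  ((List.range s.length).map (fun i => Z (s.take i ++ [s.getD i 0 + 1] ++ s.drop (i + 1)))).sum -
  ((List.range s.length).map (fun i => ((List.range (s.getD i 0 - 1)).map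
    (fun j => Z (s.take i ++ [j + 1, s.getD i 0 - j] ++ s.drop (i + 1)))).sum)).sum

/-- At `s = (2)` the mirror element is `Z(3) − Z(1,2)`. -/
theorem hoffmanElementMirror_two (Z : List ℕ → FormalRep) :
    hoffmanElementMirror Z [2] = Z [3] - Z [1, 2] := by
  simp [hoffmanElementMirror]

/-- **The mirrored statement is false** already at `s = (2)` for the canonical classes
(`ρ(1,2) = 0`, so it reads `[ζ-rep(3)] ∈ relations`), and for EVERY pinned `Z` with `Z(1,2)` of value
`≠ ζ(3)`. Any refuter reading `IsAdmissible` as "last entry `≥ 2`" would wrongly refute the crux; the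
tree's convention (head `≥ 2`, `MultipleZeta.lean`) makes the crux's placement the right one. -/
theorem mirror_false_at_two : hoffmanElementMirror zetaRep [2] ∉ relations := by
  rw [hoffmanElementMirror_two, zetaRep_of_not_isAdmissible (u := [1, 2]) (by decide), sub_zero]
  exact zetaRep_not_mem_relations (by decide)


/-! ## §3 Which MOVES any proof must use (sub-calculus invariants)

`relations` is generated by four move sets. Two cheap non-evaluative invariants of SUB-calculi locate
the crux inside the calculus:

* the **coefficient sum** `ε : FormalRep →+ ℤ`, `[r] ↦ 1`, kills every change-of-variables and every
  Newton–Leibniz generator (both have the shape `[r] − [r']`) but NOT additivity (`[r] − [r₁] − [r₂]`);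
  `ε(H(s)) = 2k − w` (`k` = depth, `w` = weight), so **unless `w = 2k` any move-proof of Hoffman(s)
  uses an additivity move** — in particular at the first live instance `s = (3)`;
* **window evaluation** `∫_{σ ∩ A} f` for a fixed measurable window `A` kills both additivity moves but
  not the other two (§3b): it separates `H(2)` from `0`, so **even Euler's instance `s = (2)` needs a
  change of variables or a Newton–Leibniz move**. -/

/-- The coefficient-sum invariant `ε [r] = 1`. -/
def coeffSum : FormalRep →+ ℤ := FreeAbelianGroup.lift fun _ => (1 : ℤ)

/-- `ε [r] = 1`. [folklore] -/
@[simp] theorem coeffSum_of {n : ℕ} (r : IntegralRep n) : coeffSum (of r) = 1 :=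
  FreeAbelianGroup.lift_apply_of _ _

/-- The sub-calculus generated by changes of variables and Newton–Leibniz moves only. -/
def covNL : AddSubgroup FormalRep := AddSubgroup.closure (changeOfVariablesRel ∪ newtonLeibnizRel)

/-- `covNL ≤ relations`. [folklore] -/
theorem covNL_le_relations : covNL ≤ relations :=
  AddSubgroup.closure_mono (by
    rintro c (hc | hc)
    · exact Or.inl (Or.inr hc)
    · exact Or.inr hc)

/-- **`ε` kills `covNL`.** [folklore] -/
theorem covNL_le_ker_coeffSum : covNL ≤ coeffSum.ker := by
  refine (AddSubgroup.closure_le _).mpr ?_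
  rintro c (hc | hc)
  · obtain ⟨n, r, r', Φ, Φ', -, -, -, -, -, rfl⟩ := hc
    simp
  · obtain ⟨n, r, r', a, b, F, -, -, -, -, -, -, -, -, rfl⟩ := hc
    simp

/-- `ε` of a pinned value at an admissible index is `1`. -/
theorem coeffSum_pinned {Z : List ℕ → FormalRep} (hZ : Pinned Z) {u : List ℕ} (hu : MZV.IsAdmissible u) :
    coeffSum (Z u) = 1 := by
  rw [hZ u hu, coeffSum_of]

/-- `Σ_{i < k} s_i = Σ s` in the `List.range/getD` indexing. [folklore] -/
theorem list_sum_range_getD (s : List ℕ) :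
    ((List.range s.length).map fun i => s.getD i 0).sum = s.sum := by
  rw [list_sum_range_map_fin]
  simp_rw [getD_fin, List.get_eq_getElem]
  exact Fin.sum_univ_getElem s

/-- **`ε(H_Z(s)) = 2k − w`**: `k` raised terms minus `Σ_i (s_i − 1) = w − k` split terms. -/
theorem coeffSum_hoffmanElement {Z : List ℕ → FormalRep} (hZ : Pinned Z) {s : List ℕ}
    (hs : MZV.IsAdmissible s) :
    coeffSum (hoffmanElement Z s) = 2 * (s.length : ℤ) - (MZV.weight s : ℤ) := by
  rw [hoffmanElement_eq, map_sub, map_list_sum, map_list_sum, List.map_map, List.map_map]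
  have h1 : ∀ i ∈ List.range s.length, (coeffSum ∘ fun i => Z (raise s i)) i = 1 := fun i hi =>
    coeffSum_pinned hZ (isAdmissible_raise hs (List.mem_range.mp hi))
  have h2 : ∀ i ∈ List.range s.length,
      (coeffSum ∘ fun i => ((List.range (s.getD i 0 - 1)).map fun j => Z (split s i j)).sum) i =
        ((s.getD i 0 - 1 : ℕ) : ℤ) := by
    intro i hi
    rw [Function.comp_apply, map_list_sum, List.map_map]
    have h3 : ∀ j ∈ List.range (s.getD i 0 - 1), (coeffSum ∘ fun j => Z (split s i j)) j = 1 :=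
      fun j hj => coeffSum_pinned hZ (isAdmissible_split hs (List.mem_range.mp hi) (List.mem_range.mp hj))
    rw [List.map_congr_left h3]
    simp
  rw [List.map_congr_left h1, List.map_congr_left h2, list_sum_range_map_fin, list_sum_range_map_fin]
  have h4 : ∀ i : Fin s.length, ((s.getD i 0 - 1 : ℕ) : ℤ) = (s.getD i 0 : ℤ) - 1 := by
    intro i
    have : 1 ≤ s.getD i 0 := by
      rw [getD_eq_getElem i.2]; exact one_le_getElem_of_isAdmissible hs i.2
    omega
  have h5 : ∑ i : Fin s.length, (s.getD i 0 : ℤ) = (MZV.weight s : ℤ) := by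
    rw [← Nat.cast_sum, MZV.weight, ← list_sum_range_getD s, list_sum_range_map_fin]
  simp only [h4, Finset.sum_sub_distrib, h5, Finset.sum_const, Finset.card_univ, Fintype.card_fin]
  ring

/-- **Additivity is load-bearing for every `s` with `w ≠ 2k`**: then `H_Z(s)` is not in the
sub-calculus of changes of variables and Newton–Leibniz moves. (For `w = 2k` see §5: the self-dual
indices, where `H(s)` IS a sum of single changes of variables.) [folklore] -/
theorem not_mem_covNL {Z : List ℕ → FormalRep} (hZ : Pinned Z) {s : List ℕ} (hs : MZV.IsAdmissible s)
    (hw : MZV.weight s ≠ 2 * s.length) : hoffmanElement Z s ∉ covNL := by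
  intro h
  have h0 : coeffSum (hoffmanElement Z s) = 0 := covNL_le_ker_coeffSum h
  rw [coeffSum_hoffmanElement hZ hs] at h0
  omega

/-- The first live instance `s = (3)` (`ζ(4) = ζ(3,1) + ζ(2,2)`): `ε = −1`, additivity is needed. -/
theorem three_not_mem_covNL {Z : List ℕ → FormalRep} (hZ : Pinned Z) : hoffmanElement Z [3] ∉ covNL :=
  not_mem_covNL hZ (by decide) (by decide)

/-- Every odd-weight instance needs additivity. -/
theorem not_mem_covNL_of_odd {Z : List ℕ → FormalRep} (hZ : Pinned Z) {s : List ℕ}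
    (hs : MZV.IsAdmissible s) (hw : Odd (MZV.weight s)) : hoffmanElement Z s ∉ covNL :=
  not_mem_covNL hZ hs fun h => by rw [h] at hw; exact (Nat.not_odd_iff_even.mpr (even_two_mul _)) hw


/-! ### §3b Window evaluation: the additivity moves alone prove neither `s = (2)` nor `s = (3)`

For a fixed family of measurable windows `A n ⊆ ℝⁿ`, `[σ, f] ↦ ∫_{σ ∩ A n} f` is additive in the domain
(null overlaps stay null) and in the integrand, so it kills the sub-calculus `addOnly` generated by the
two additivity moves; it is NOT invariant under changes of variables or Newton–Leibniz. On a small box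
inside the simplex where `ω₀(t₁) = 1/t₁` beats `ω₁(t₁) = 1/(1 − t₁)` it separates Hoffman's elements
at `s = (2)` and `s = (3)` from `0`: **any move-proof of Euler's `ζ(3) = ζ(2,1)` or of
`ζ(4) = ζ(3,1) + ζ(2,2)` uses a change of variables or a Newton–Leibniz (Stokes) move.** Together with
§3a: a proof of the first live instance `s = (3)` uses an additivity move AND a non-additive move. -/

section Window

/-- Box windows in every dimension, with endpoints read off two sequences. -/
def window (a b : ℕ → ℝ) (n : ℕ) : Set (Fin n → ℝ) := {t | ∀ i : Fin n, t i ∈ Ioo (a i) (b i)}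

/-- A window is a product of open intervals. [folklore] -/
theorem window_eq_pi (a b : ℕ → ℝ) (n : ℕ) :
    window a b n = Set.pi univ fun i : Fin n => Ioo (a i) (b i) := by
  ext t; simp [window]

/-- Windows are open. [folklore] -/
theorem isOpen_window (a b : ℕ → ℝ) (n : ℕ) : IsOpen (window a b n) := by
  rw [window_eq_pi]
  exact isOpen_set_pi finite_univ fun i _ => isOpen_Ioo

/-- Windows are measurable. [folklore] -/
theorem measurableSet_window (a b : ℕ → ℝ) (n : ℕ) : MeasurableSet (window a b n) :=
  (isOpen_window a b n).measurableSet

/-- **Window evaluation** `[σ, f] ↦ ∫_{σ ∩ A n} f`. -/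
def windowEval (A : (n : ℕ) → Set (Fin n → ℝ)) : FormalRep →+ ℝ :=
  FreeAbelianGroup.lift fun r => ∫ x in r.2.domain ∩ A r.1, r.2.integrand x

/-- Window evaluation of a generator. [folklore] -/
@[simp] theorem windowEval_of (A : (n : ℕ) → Set (Fin n → ℝ)) {n : ℕ} (r : IntegralRep n) :
    windowEval A (of r) = ∫ x in r.domain ∩ A n, r.integrand x :=
  FreeAbelianGroup.lift_apply_of _ _

/-- The sub-calculus generated by the two additivity moves only. -/
def addOnly : AddSubgroup FormalRep := AddSubgroup.closure (domainAddRel ∪ integrandAddRel)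

/-- `addOnly ≤ relations`. [folklore] -/
theorem addOnly_le_relations : addOnly ≤ relations :=
  AddSubgroup.closure_mono (by
    rintro c (hc | hc)
    · exact Or.inl (Or.inl (Or.inl hc))
    · exact Or.inl (Or.inl (Or.inr hc)))

/-- **Window evaluation kills `addOnly`.** [folklore] -/
theorem addOnly_le_ker_windowEval {A : (n : ℕ) → Set (Fin n → ℝ)} (hA : ∀ n, MeasurableSet (A n)) :
    addOnly ≤ (windowEval A).ker := by
  refine (AddSubgroup.closure_le _).mpr ?_
  rintro c (hc | hc)
  · obtain ⟨n, r, r₁, r₂, hdom, hnull, h₁, h₂, rfl⟩ := hc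
    simp only [SetLike.mem_coe, AddMonoidHom.mem_ker, map_sub, windowEval_of]
    rw [sub_sub, sub_eq_zero]
    have hm₁ : MeasurableSet (r₁.domain ∩ A n) := (IntegralRep.measurableSet_domain_holds r₁).inter (hA n)
    have hm₂ : MeasurableSet (r₂.domain ∩ A n) := (IntegralRep.measurableSet_domain_holds r₂).inter (hA n)
    have hsub : (r₁.domain ∩ A n) ∩ (r₂.domain ∩ A n) ⊆ r₁.domain ∩ r₂.domain :=
      fun x hx => ⟨hx.1.1, hx.2.1⟩
    have hae : AEDisjoint volume (r₁.domain ∩ A n) (r₂.domain ∩ A n) := measure_mono_null hsub hnull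
    have hunion : r.domain ∩ A n = (r₁.domain ∩ A n) ∪ (r₂.domain ∩ A n) := by
      rw [hdom, Set.union_inter_distrib_right]
    have hi₁ : IntegrableOn r.integrand (r₁.domain ∩ A n) :=
      r.integrableOn.mono_set (by rw [hdom]; exact inter_subset_left.trans subset_union_left)
    have hi₂ : IntegrableOn r.integrand (r₂.domain ∩ A n) :=
      r.integrableOn.mono_set (by rw [hdom]; exact inter_subset_left.trans subset_union_right)
    rw [hunion, setIntegral_union₀ hae hm₂.nullMeasurableSet hi₁ hi₂,
      setIntegral_congr_fun hm₁ (h₁.mono inter_subset_left),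
      setIntegral_congr_fun hm₂ (h₂.mono inter_subset_left)]
  · obtain ⟨n, r, r₁, r₂, h₁, h₂, hadd, rfl⟩ := hc
    simp only [SetLike.mem_coe, AddMonoidHom.mem_ker, map_sub, windowEval_of]
    rw [sub_sub, sub_eq_zero, h₁, h₂]
    have hm : MeasurableSet (r.domain ∩ A n) := (IntegralRep.measurableSet_domain_holds r).inter (hA n)
    rw [setIntegral_congr_fun hm (hadd.mono inter_subset_left)]
    exact integral_add ((h₁ ▸ r₁.integrableOn).mono_set inter_subset_left)
      ((h₂ ▸ r₂.integrableOn).mono_set inter_subset_left)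

/-- A function positive on a nonempty open set, integrable there, has positive integral. [folklore] -/
theorem setIntegral_pos_of_pos_on {n : ℕ} {U : Set (Fin n → ℝ)} (hU : IsOpen U) (hne : U.Nonempty)
    {f : (Fin n → ℝ) → ℝ} (hf : ∀ x ∈ U, 0 < f x) (hfi : IntegrableOn f U) : 0 < ∫ x in U, f x := by
  have h0 : 0 ≤ᵐ[volume.restrict U] f := by
    rw [Filter.EventuallyLE, ae_restrict_iff' hU.measurableSet]
    exact Filter.Eventually.of_forall fun x hx => (hf x hx).le
  rw [setIntegral_pos_iff_support_of_nonneg_ae h0 hfi]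
  have : Function.support f ∩ U = U := Set.inter_eq_right.mpr fun x hx => (hf x hx).ne'
  rw [this]
  exact hU.measure_pos volume hne

/-- The integrand of `ζ(3)`: `ω₀ω₀ω₁`. -/
theorem mzvIntegrand_three (t : Fin 3 → ℝ) :
    mzvIntegrand [3] t = (t 0)⁻¹ * (t 1)⁻¹ * (1 - t 2)⁻¹ := by
  change (∏ i : Fin 3, mzvForm ((MZV.binaryWord [3]).getD i false) (t i)) = _
  simp [Fin.prod_univ_three, mzvForm, MZV.binaryWord]

/-- The integrand of `ζ(2,1)`: `ω₀ω₁ω₁`. -/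
theorem mzvIntegrand_two_one (t : Fin 3 → ℝ) :
    mzvIntegrand [2, 1] t = (t 0)⁻¹ * (1 - t 1)⁻¹ * (1 - t 2)⁻¹ := by
  change (∏ i : Fin 3, mzvForm ((MZV.binaryWord [2, 1]).getD i false) (t i)) = _
  simp [Fin.prod_univ_three, mzvForm, MZV.binaryWord]

/-- Lower endpoints of the weight-3 box `(1/2,3/5) × (3/10,2/5) × (1/10,1/5)`. -/
def lo₃ : ℕ → ℝ := fun i => (([1/2, 3/10, 1/10] : List ℚ).getD i 0 : ℚ)
/-- Upper endpoints of the weight-3 box. -/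
def hi₃ : ℕ → ℝ := fun i => (([3/5, 2/5, 1/5] : List ℚ).getD i 0 : ℚ)

/-- Coordinates of a point of the weight-3 box. [folklore] -/
theorem mem_window₃ {t : Fin 3 → ℝ} (ht : t ∈ window lo₃ hi₃ 3) :
    1/2 < t 0 ∧ t 0 < 3/5 ∧ 3/10 < t 1 ∧ t 1 < 2/5 ∧ 1/10 < t 2 ∧ t 2 < 1/5 := by
  have h0 := ht 0; have h1 := ht 1; have h2 := ht 2
  simp only [lo₃, hi₃, mem_Ioo] at h0 h1 h2
  norm_num at h0 h1 h2
  exact ⟨h0.1, h0.2, h1.1, h1.2, h2.1, h2.2⟩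

/-- The weight-3 box lies in the open ordered simplex. [folklore] -/
theorem window₃_subset : window lo₃ hi₃ 3 ⊆ openOrderedSimplex 3 := by
  intro t ht
  obtain ⟨h0, h0', h1, h1', h2, h2'⟩ := mem_window₃ ht
  refine ⟨fun i => ?_, fun i => ?_, fun i j hij => ?_⟩
  · fin_cases i <;> simp <;> linarith
  · fin_cases i <;> simp <;> linarith
  · fin_cases i <;> fin_cases j <;> simp at hij ⊢ <;> linarith

/-- The weight-3 box is nonempty. [folklore] -/
theorem window₃_nonempty : (window lo₃ hi₃ 3).Nonempty := by
  refine ⟨![11/20, 7/20, 3/20], fun i => ?_⟩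
  fin_cases i <;> simp [lo₃, hi₃] <;> norm_num

/-- **The window separates `H(2)` from `0`**: `∫_B (ω₀ω₀ω₁ − ω₀ω₁ω₁) > 0` on the box `B`, where
`1/t₁ > 1/(1 − t₁)`. -/
theorem windowEval_hoffmanElement_two_pos : 0 < windowEval (window lo₃ hi₃) (hoffmanElement zetaRep [2]) := by
  have h3 : MZV.IsAdmissible [3] := by decide
  have h21 : MZV.IsAdmissible [2, 1] := by decide
  rw [hoffmanElement_two, zetaRep_of_isAdmissible h3, zetaRep_of_isAdmissible h21, map_sub, windowEval_of,
    windowEval_of]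
  change 0 < (∫ x in openOrderedSimplex 3 ∩ window lo₃ hi₃ 3, mzvIntegrand [3] x) -
    ∫ x in openOrderedSimplex 3 ∩ window lo₃ hi₃ 3, mzvIntegrand [2, 1] x
  rw [inter_eq_right.mpr window₃_subset]
  have hi3 : IntegrableOn (fun x : Fin 3 → ℝ => mzvIntegrand [3] x) (window lo₃ hi₃ 3) :=
    (mzvIntegrand_integrableOn_holds [3] h3).mono_set window₃_subset
  have hi21 : IntegrableOn (fun x : Fin 3 → ℝ => mzvIntegrand [2, 1] x) (window lo₃ hi₃ 3) :=
    (mzvIntegrand_integrableOn_holds [2, 1] h21).mono_set window₃_subset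
  rw [← integral_sub hi3 hi21]
  refine setIntegral_pos_of_pos_on (isOpen_window _ _ _) window₃_nonempty (fun t ht => ?_) (hi3.sub hi21)
  obtain ⟨h0, h0', h1, h1', h2, h2'⟩ := mem_window₃ ht
  rw [mzvIntegrand_three, mzvIntegrand_two_one]
  have A : 0 < (t 0)⁻¹ := by positivity
  have B : 0 < (1 - t 2)⁻¹ := inv_pos.mpr (by linarith)
  have C : (1 - t 1)⁻¹ < (t 1)⁻¹ := by
    rw [inv_lt_inv₀ (by linarith) (by linarith)]; linarith
  have e : (t 0)⁻¹ * (t 1)⁻¹ * (1 - t 2)⁻¹ - (t 0)⁻¹ * (1 - t 1)⁻¹ * (1 - t 2)⁻¹ =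
      (t 0)⁻¹ * (1 - t 2)⁻¹ * ((t 1)⁻¹ - (1 - t 1)⁻¹) := by ring
  rw [e]
  exact mul_pos (mul_pos A B) (sub_pos.mpr C)

/-- **Additivity alone does not prove Euler's instance `s = (2)`**: any move-proof of `ζ(3) = ζ(2,1)`
uses a change of variables or a Newton–Leibniz move. [folklore] -/
theorem two_not_mem_addOnly : hoffmanElement zetaRep [2] ∉ addOnly := by
  intro h
  have h0 := addOnly_le_ker_windowEval (A := window lo₃ hi₃) (fun n => measurableSet_window _ _ n) h
  rw [AddMonoidHom.mem_ker] at h0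
  exact (windowEval_hoffmanElement_two_pos).ne' h0


/-! #### The same at the first live instance `s = (3)` (weight 4) -/

/-- The integrand of `ζ(4)`: `ω₀ω₀ω₀ω₁`. -/
theorem mzvIntegrand_four (t : Fin 4 → ℝ) :
    mzvIntegrand [4] t = (t 0)⁻¹ * (t 1)⁻¹ * (t 2)⁻¹ * (1 - t 3)⁻¹ := by
  change (∏ i : Fin 4, mzvForm ((MZV.binaryWord [4]).getD i false) (t i)) = _
  simp [Fin.prod_univ_four, mzvForm, MZV.binaryWord]

/-- The integrand of `ζ(3,1)`: `ω₀ω₀ω₁ω₁`. -/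
theorem mzvIntegrand_three_one (t : Fin 4 → ℝ) :
    mzvIntegrand [3, 1] t = (t 0)⁻¹ * (t 1)⁻¹ * (1 - t 2)⁻¹ * (1 - t 3)⁻¹ := by
  change (∏ i : Fin 4, mzvForm ((MZV.binaryWord [3, 1]).getD i false) (t i)) = _
  simp [Fin.prod_univ_four, mzvForm, MZV.binaryWord]

/-- The integrand of `ζ(2,2)`: `ω₀ω₁ω₀ω₁`. -/
theorem mzvIntegrand_two_two (t : Fin 4 → ℝ) :
    mzvIntegrand [2, 2] t = (t 0)⁻¹ * (1 - t 1)⁻¹ * (t 2)⁻¹ * (1 - t 3)⁻¹ := by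
  change (∏ i : Fin 4, mzvForm ((MZV.binaryWord [2, 2]).getD i false) (t i)) = _
  simp [Fin.prod_univ_four, mzvForm, MZV.binaryWord]

/-- Lower endpoints of the weight-4 box `(1/2,3/5) × (1/5,1/4) × (3/20,1/5) × (1/20,1/10)`. -/
def lo₄ : ℕ → ℝ := fun i => (([1/2, 1/5, 3/20, 1/20] : List ℚ).getD i 0 : ℚ)
/-- Upper endpoints of the weight-4 box. -/
def hi₄ : ℕ → ℝ := fun i => (([3/5, 1/4, 1/5, 1/10] : List ℚ).getD i 0 : ℚ)

/-- Coordinates of a point of the weight-4 box. [folklore] -/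
theorem mem_window₄ {t : Fin 4 → ℝ} (ht : t ∈ window lo₄ hi₄ 4) :
    1/2 < t 0 ∧ t 0 < 3/5 ∧ 1/5 < t 1 ∧ t 1 < 1/4 ∧ 3/20 < t 2 ∧ t 2 < 1/5 ∧ 1/20 < t 3 ∧ t 3 < 1/10 := by
  have h0 := ht 0; have h1 := ht 1; have h2 := ht 2; have h3 := ht 3
  simp only [lo₄, hi₄, mem_Ioo] at h0 h1 h2 h3
  norm_num at h0 h1 h2 h3
  exact ⟨h0.1, h0.2, h1.1, h1.2, h2.1, h2.2, h3.1, h3.2⟩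

/-- The weight-4 box lies in the open ordered simplex. [folklore] -/
theorem window₄_subset : window lo₄ hi₄ 4 ⊆ openOrderedSimplex 4 := by
  intro t ht
  obtain ⟨h0, h0', h1, h1', h2, h2', h3, h3'⟩ := mem_window₄ ht
  refine ⟨fun i => ?_, fun i => ?_, fun i j hij => ?_⟩
  · fin_cases i <;> simp <;> linarith
  · fin_cases i <;> simp <;> linarith
  · fin_cases i <;> fin_cases j <;> simp at hij ⊢ <;> linarith

/-- The weight-4 box is nonempty. [folklore] -/
theorem window₄_nonempty : (window lo₄ hi₄ 4).Nonempty := by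
  refine ⟨![11/20, 9/40, 7/40, 3/40], fun i => ?_⟩
  fin_cases i <;> simp [lo₄, hi₄] <;> norm_num

/-- Pointwise positivity of `ω₀ω₀ω₀ω₁ − ω₀ω₀ω₁ω₁ − ω₀ω₁ω₀ω₁` on the weight-4 box: after the common factor
`1/(t₀(1 − t₃) t₁ t₂ (1 − t₁)(1 − t₂))` it is `1 − 2t₁ − 2t₂ + 3t₁t₂ > 1/10`. -/
theorem integrand_gap_pos₄ {t : Fin 4 → ℝ} (ht : t ∈ window lo₄ hi₄ 4) :
    0 < mzvIntegrand [4] t - (mzvIntegrand [3, 1] t + mzvIntegrand [2, 2] t) := by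
  obtain ⟨h0, h0', h1, h1', h2, h2', h3, h3'⟩ := mem_window₄ ht
  rw [mzvIntegrand_four, mzvIntegrand_three_one, mzvIntegrand_two_two]
  have n0 : t 0 ≠ 0 := by positivity
  have n1 : t 1 ≠ 0 := by positivity
  have n2 : t 2 ≠ 0 := by positivity
  have m1 : 1 - t 1 ≠ 0 := by linarith
  have m2 : 1 - t 2 ≠ 0 := by linarith
  have m3 : 1 - t 3 ≠ 0 := by linarith
  have key : (t 0)⁻¹ * (t 1)⁻¹ * (t 2)⁻¹ * (1 - t 3)⁻¹ -
      ((t 0)⁻¹ * (t 1)⁻¹ * (1 - t 2)⁻¹ * (1 - t 3)⁻¹ + (t 0)⁻¹ * (1 - t 1)⁻¹ * (t 2)⁻¹ * (1 - t 3)⁻¹) =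
      (1 - 2 * t 1 - 2 * t 2 + 3 * (t 1 * t 2)) / (t 0 * (1 - t 3) * t 1 * t 2 * (1 - t 1) * (1 - t 2)) := by
    field_simp
    ring
  rw [key]
  apply div_pos
  · nlinarith [mul_pos (show (0:ℝ) < t 1 by linarith) (show (0:ℝ) < t 2 by linarith)]
  · have : 0 < t 1 * t 2 := mul_pos (by linarith) (by linarith)
    have : 0 < t 0 * (1 - t 3) := mul_pos (by linarith) (by linarith)
    have : 0 < (1 - t 1) * (1 - t 2) := mul_pos (by linarith) (by linarith)
    nlinarith [mul_pos (mul_pos ‹0 < t 0 * (1 - t 3)› ‹0 < t 1 * t 2›) ‹0 < (1 - t 1) * (1 - t 2)›]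

/-- **The window separates `H(3)` from `0`.** -/
theorem windowEval_hoffmanElement_three_pos :
    0 < windowEval (window lo₄ hi₄) (hoffmanElement zetaRep [3]) := by
  have h4 : MZV.IsAdmissible [4] := by decide
  have h31 : MZV.IsAdmissible [3, 1] := by decide
  have h22 : MZV.IsAdmissible [2, 2] := by decide
  rw [hoffmanElement_three, zetaRep_of_isAdmissible h4, zetaRep_of_isAdmissible h31,
    zetaRep_of_isAdmissible h22, map_sub, map_add, windowEval_of, windowEval_of, windowEval_of]
  change 0 < (∫ x in openOrderedSimplex 4 ∩ window lo₄ hi₄ 4, mzvIntegrand [4] x) -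
    ((∫ x in openOrderedSimplex 4 ∩ window lo₄ hi₄ 4, mzvIntegrand [3, 1] x) +
      ∫ x in openOrderedSimplex 4 ∩ window lo₄ hi₄ 4, mzvIntegrand [2, 2] x)
  rw [inter_eq_right.mpr window₄_subset]
  have i4 : IntegrableOn (fun x : Fin 4 → ℝ => mzvIntegrand [4] x) (window lo₄ hi₄ 4) :=
    (mzvIntegrand_integrableOn_holds [4] h4).mono_set window₄_subset
  have i31 : IntegrableOn (fun x : Fin 4 → ℝ => mzvIntegrand [3, 1] x) (window lo₄ hi₄ 4) :=
    (mzvIntegrand_integrableOn_holds [3, 1] h31).mono_set window₄_subset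
  have i22 : IntegrableOn (fun x : Fin 4 → ℝ => mzvIntegrand [2, 2] x) (window lo₄ hi₄ 4) :=
    (mzvIntegrand_integrableOn_holds [2, 2] h22).mono_set window₄_subset
  have i3122 : IntegrableOn (fun x : Fin 4 → ℝ => mzvIntegrand [3, 1] x + mzvIntegrand [2, 2] x)
      (window lo₄ hi₄ 4) := i31.add i22
  rw [← integral_add i31 i22, ← integral_sub i4 i3122]
  exact setIntegral_pos_of_pos_on (isOpen_window _ _ _) window₄_nonempty (fun t ht => integrand_gap_pos₄ ht)
    (i4.sub i3122)

/-- **Additivity alone does not prove `s = (3)`** (`ζ(4) = ζ(3,1) + ζ(2,2)`); with §3a (`ε = −1`):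
any move-proof of the first live instance uses BOTH an additivity move and a change of variables or
Newton–Leibniz move. [folklore] -/
theorem three_not_mem_addOnly : hoffmanElement zetaRep [3] ∉ addOnly := by
  intro h
  have h0 := addOnly_le_ker_windowEval (A := window lo₄ hi₄) (fun n => measurableSet_window _ _ n) h
  rw [AddMonoidHom.mem_ker] at h0
  exact (windowEval_hoffmanElement_three_pos).ne' h0

end Window

/-! ### §3c No-Stokes locality: without Newton–Leibniz there are no auxiliary variables

The three Stokes-free move sets are homogeneous in the dimension, so the projection `P_n` of
`FormalRep` onto its dimension-`n` generators maps the Stokes-free sub-calculus `noStokes` into its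
dimension-`n` part. Hoffman's element at `s` is pure of dimension `w + 1`; hence **a move-proof of
Hoffman(s) avoiding Newton–Leibniz is a chain among `(w+1)`-dimensional representations only** — no
extra variable, no product with an interval, no homotopy parameter. Every chain proposed so far for
`s = (3)` (the crux ideas `dilation-homotopy-transposition`, `collar-blowup-uphill-stokes`, the route's
own pentagon/Stokes-on-`X₅` lever) introduces a variable and descends by Newton–Leibniz; by this
locality that is not an artefact of presentation unless a purely 4-dimensional scissors-and-substitution
proof of `ζ(4) = ζ(3,1) + ζ(2,2)` exists (OPEN; cf. route ScissorsAvatars). The precise open question is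
CONSERVATIVITY: is `relations ∩ (dimension n) = noStokesDim n`? Note that the only non-emulable power
of Newton–Leibniz is the change of dimension: a fibrewise primitive that is semialgebraic and piecewise
monotone in `t` can itself serve as a change of variables `t ↦ F(x, t)` inside dimension `n + 1`, so
up-and-down excursions through an auxiliary variable are the whole content of the question. -/

section NoStokes

/-- Projection of `FormalRep` onto its dimension-`n` generators. -/
def dimProj (n : ℕ) : FormalRep →+ FormalRep :=
  FreeAbelianGroup.lift fun r => if r.1 = n then FreeAbelianGroup.of r else 0

/-- `P_n [r] = [r]` if `r` has dimension `n`, else `0`. [folklore] -/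
theorem dimProj_of (n : ℕ) {m : ℕ} (r : IntegralRep m) :
    dimProj n (of r) = if m = n then of r else 0 := by
  simp only [dimProj, of, FreeAbelianGroup.lift_apply_of]

/-- `P_n` fixes dimension-`n` generators. [folklore] -/
@[simp] theorem dimProj_of_self {n : ℕ} (r : IntegralRep n) : dimProj n (of r) = of r := by
  rw [dimProj_of, if_pos rfl]

/-- `P_n` kills generators of other dimensions. [folklore] -/
theorem dimProj_of_ne {n m : ℕ} (r : IntegralRep m) (h : m ≠ n) : dimProj n (of r) = 0 := by
  rw [dimProj_of, if_neg h]

/-- Domain additivity among `n`-dimensional representations. -/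
def domainAddRelDim (n : ℕ) : Set FormalRep :=
  {c | ∃ (r r₁ r₂ : IntegralRep n), r.domain = r₁.domain ∪ r₂.domain ∧
    volume (r₁.domain ∩ r₂.domain) = 0 ∧ EqOn r.integrand r₁.integrand r₁.domain ∧
    EqOn r.integrand r₂.integrand r₂.domain ∧ c = of r - of r₁ - of r₂}

/-- Integrand additivity among `n`-dimensional representations. -/
def integrandAddRelDim (n : ℕ) : Set FormalRep :=
  {c | ∃ (r r₁ r₂ : IntegralRep n), r₁.domain = r.domain ∧ r₂.domain = r.domain ∧
    EqOn r.integrand (r₁.integrand + r₂.integrand) r.domain ∧ c = of r - of r₁ - of r₂}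

/-- Changes of variables among `n`-dimensional representations. -/
def changeOfVariablesRelDim (n : ℕ) : Set FormalRep :=
  {c | ∃ (r r' : IntegralRep n) (Φ : (Fin n → ℝ) → (Fin n → ℝ))
      (Φ' : (Fin n → ℝ) → (Fin n → ℝ) →L[ℝ] (Fin n → ℝ)),
    IsSemialgebraicMapOn ℚ r.domain Φ ∧ (∀ x ∈ r.domain, HasFDerivWithinAt Φ (Φ' x) r.domain x) ∧
    InjOn Φ r.domain ∧ r'.domain = Φ '' r.domain ∧
    (∀ x ∈ r.domain, r.integrand x = r'.integrand (Φ x) * |(Φ' x).det|) ∧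
    c = of r - of r'}

/-- The Stokes-free sub-calculus (moves (1a), (1b), (2)). -/
def noStokes : AddSubgroup FormalRep :=
  AddSubgroup.closure (domainAddRel ∪ integrandAddRel ∪ changeOfVariablesRel)

/-- Its dimension-`n` part: the same three moves among `n`-dimensional representations. -/
def noStokesDim (n : ℕ) : AddSubgroup FormalRep :=
  AddSubgroup.closure (domainAddRelDim n ∪ integrandAddRelDim n ∪ changeOfVariablesRelDim n)

/-- `noStokes ≤ relations`. [folklore] -/
theorem noStokes_le_relations : noStokes ≤ relations :=
  AddSubgroup.closure_mono fun _ hc => Or.inl hc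

/-- The dimension-`n` Stokes-free moves are Stokes-free moves. [folklore] -/
theorem noStokesDim_le_noStokes (n : ℕ) : noStokesDim n ≤ noStokes := by
  refine AddSubgroup.closure_mono ?_
  rintro c ((hc | hc) | hc)
  · obtain ⟨r, r₁, r₂, h1, h2, h3, h4, rfl⟩ := hc
    exact Or.inl (Or.inl ⟨n, r, r₁, r₂, h1, h2, h3, h4, rfl⟩)
  · obtain ⟨r, r₁, r₂, h1, h2, h3, rfl⟩ := hc
    exact Or.inl (Or.inr ⟨n, r, r₁, r₂, h1, h2, h3, rfl⟩)
  · obtain ⟨r, r', Φ, Φ', h1, h2, h3, h4, h5, rfl⟩ := hc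
    exact Or.inr ⟨n, r, r', Φ, Φ', h1, h2, h3, h4, h5, rfl⟩

/-- **Locality**: the dimension-`n` projection of a Stokes-free relation is a Stokes-free relation among
`n`-dimensional representations. -/
theorem dimProj_mem_noStokesDim (n : ℕ) {c : FormalRep} (hc : c ∈ noStokes) :
    dimProj n c ∈ noStokesDim n := by
  induction hc using AddSubgroup.closure_induction with
  | mem x hx =>
    rcases hx with (hx | hx) | hx
    · obtain ⟨m, r, r₁, r₂, h1, h2, h3, h4, rfl⟩ := hx
      by_cases hmn : m = n
      · subst hmn
        simp only [map_sub, dimProj_of_self]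
        exact AddSubgroup.subset_closure (Or.inl (Or.inl ⟨r, r₁, r₂, h1, h2, h3, h4, rfl⟩))
      · simp [map_sub, dimProj_of_ne _ hmn]
    · obtain ⟨m, r, r₁, r₂, h1, h2, h3, rfl⟩ := hx
      by_cases hmn : m = n
      · subst hmn
        simp only [map_sub, dimProj_of_self]
        exact AddSubgroup.subset_closure (Or.inl (Or.inr ⟨r, r₁, r₂, h1, h2, h3, rfl⟩))
      · simp [map_sub, dimProj_of_ne _ hmn]
    · obtain ⟨m, r, r', Φ, Φ', h1, h2, h3, h4, h5, rfl⟩ := hx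
      by_cases hmn : m = n
      · subst hmn
        simp only [map_sub, dimProj_of_self]
        exact AddSubgroup.subset_closure (Or.inr ⟨r, r', Φ, Φ', h1, h2, h3, h4, h5, rfl⟩)
      · simp [map_sub, dimProj_of_ne _ hmn]
  | zero => simp
  | add x y _ _ hx hy => rw [map_add]; exact AddSubgroup.add_mem _ hx hy
  | neg x _ hx => rw [map_neg]; exact AddSubgroup.neg_mem _ hx

/-- A dimension-pure Stokes-free relation is a Stokes-free relation IN ITS OWN DIMENSION. -/
theorem mem_noStokesDim_of_pure {n : ℕ} {c : FormalRep} (hc : c ∈ noStokes) (hpure : dimProj n c = c) :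
    c ∈ noStokesDim n := hpure ▸ dimProj_mem_noStokesDim n hc

/-- Raising adds one to the weight. -/
theorem weight_raise {s : List ℕ} {i : ℕ} (hi : i < s.length) : MZV.weight (raise s i) = MZV.weight s + 1 := by
  induction s generalizing i with
  | nil => simp at hi
  | cons a t ih =>
    cases i with
    | zero => simp [MZV.weight]; omega
    | succ i =>
      have hi' : i < t.length := by simpa using hi
      have := ih hi'
      simp only [MZV.weight, raise_cons_succ, List.sum_cons] at this ⊢
      omega

/-- Splitting adds one to the weight. -/
theorem weight_split {s : List ℕ} {i j : ℕ} (hi : i < s.length) (hj : j < s.getD i 0 - 1) :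
    MZV.weight (split s i j) = MZV.weight s + 1 := by
  induction s generalizing i with
  | nil => simp at hi
  | cons a t ih =>
    cases i with
    | zero =>
      simp only [List.getD_cons_zero] at hj
      simp [MZV.weight]; omega
    | succ i =>
      have hi' : i < t.length := by simpa using hi
      simp only [List.getD_cons_succ] at hj
      have := ih hi' hj
      simp only [MZV.weight, split_cons_succ, List.sum_cons] at this ⊢
      omega

/-- Hoffman's element is pure of dimension `w + 1`. -/
theorem dimProj_hoffmanElement {Z : List ℕ → FormalRep} (hZ : Pinned Z) {s : List ℕ}
    (hs : MZV.IsAdmissible s) : dimProj (MZV.weight s + 1) (hoffmanElement Z s) = hoffmanElement Z s := by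
  rw [hoffmanElement_eq, map_sub, map_list_sum, map_list_sum, List.map_map, List.map_map]
  congr 1
  · congr 1
    refine List.map_congr_left fun i hi => ?_
    have hi' := List.mem_range.mp hi
    rw [Function.comp_apply, hZ _ (isAdmissible_raise hs hi'), dimProj_of, if_pos (weight_raise hi')]
  · congr 1
    refine List.map_congr_left fun i hi => ?_
    have hi' := List.mem_range.mp hi
    rw [Function.comp_apply, map_list_sum, List.map_map]
    congr 1
    refine List.map_congr_left fun j hj => ?_
    have hj' := List.mem_range.mp hj
    rw [Function.comp_apply, hZ _ (isAdmissible_split hs hi' hj'), dimProj_of, if_pos (weight_split hi' hj')]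

/-- **No-Stokes locality for the crux**: a Newton–Leibniz-free move-proof of Hoffman(s) is a chain of
domain/integrand additivity and changes of variables among `(w+1)`-dimensional representations only.
[folklore] -/
theorem noStokes_locality {Z : List ℕ → FormalRep} (hZ : Pinned Z) {s : List ℕ} (hs : MZV.IsAdmissible s)
    (h : hoffmanElement Z s ∈ noStokes) : hoffmanElement Z s ∈ noStokesDim (MZV.weight s + 1) :=
  mem_noStokesDim_of_pure h (dimProj_hoffmanElement hZ hs)

/-- In particular at `s = (3)`: a Stokes-free proof of `ζ(4) = ζ(3,1) + ζ(2,2)` would be a purely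
4-dimensional scissors-and-substitution chain. -/
theorem noStokes_locality_three (h : hoffmanElement zetaRep [3] ∈ noStokes) :
    hoffmanElement zetaRep [3] ∈ noStokesDim 4 := by
  have h4 : MZV.weight [3] + 1 = 4 := by decide
  have := noStokes_locality pinned_zetaRep (s := [3]) (by decide) h
  rwa [h4] at this

/-- Newton–Leibniz generators are never dimension-pure: `P_n` of `[band] − [base]` (band in dimension
`n + 1`) is `−[base]`, and `P_{n+1}` of it is `[band]`; neither is a relation unless of value `0`. This
is the only move the locality argument does not cover — the whole question "is Stokes needed for
Hoffman?" is concentrated here. -/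
theorem dimProj_newtonLeibniz_shape {n : ℕ} (r : IntegralRep (n + 1)) (r' : IntegralRep n) :
    dimProj n (of r - of r') = -of r' ∧ dimProj (n + 1) (of r - of r') = of r := by
  constructor
  · rw [map_sub, dimProj_of_ne r (Nat.succ_ne_self n), dimProj_of_self, zero_sub]
  · rw [map_sub, dimProj_of_self, dimProj_of_ne r' (by omega), sub_zero]

end NoStokes

/-! ## §4 Natural strengthenings, refuted

* **termwise** (one raised term against its own splits, position by position) — false at `s = (2,1)`,
  BOTH positions: position `1` reads `[ζ-rep(2,2)] ∈ relations`, position `0` reads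
  `[ζ-rep(3,1)] − [ζ-rep(2,1,1)] ∈ relations`, of value `−ζ(2,2)`;
* **on the nose** (`H_Z(s) = 0` in the free group) — false at `s = (2)` (the two representations of
  `ζ(3)` and `ζ(2,1)` are distinct generators), so the relation subgroup is genuinely used;
* **without additivity / without a non-additive move** — §3;
* **beyond admissibility by zero-regularisation** — §2(b). -/

/-- The termwise strengthening: each raised index against its own splits. -/
def HoffmanTermwise : Prop :=
  ∀ Z : List ℕ → FormalRep, Pinned Z → ∀ s : List ℕ, MZV.IsAdmissible s → ∀ i < s.length,
    Z (raise s i) - ((List.range (s.getD i 0 - 1)).map fun j => Z (split s i j)).sum ∈ relations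

/-- **Termwise Hoffman is false** (witness `s = (2,1)`, position `1`: `[ζ-rep(2,2)] ∉ relations`). -/
theorem not_hoffmanTermwise : ¬ HoffmanTermwise := by
  intro h
  have := h zetaRep pinned_zetaRep [2, 1] (by decide) 1 (by decide)
  have e : raise [2, 1] 1 = [2, 2] := by decide
  rw [e] at this
  simp only [List.getD_cons_succ, List.getD_cons_zero, le_refl, tsub_eq_zero_of_le, List.range_zero,
    List.map_nil, List.sum_nil, sub_zero] at this
  exact zetaRep_not_mem_relations (by decide) this

/-- Position `0` of `s = (2,1)` fails as well: `[ζ-rep(3,1)] − [ζ-rep(2,1,1)]` has value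
`ζ(3,1) − ζ(2,1,1) = −ζ(2,2) ≠ 0` (`multipleZeta_two_one_one_eq_add`). -/
theorem termwise_false_at_two_one_zero : zetaRep [3, 1] - zetaRep [2, 1, 1] ∉ relations := by
  intro h
  have h0 : eval (zetaRep [3, 1] - zetaRep [2, 1, 1]) = 0 := relations_le_ker_eval_holds h
  rw [map_sub, eval_zetaRep (by decide), eval_zetaRep (by decide), multipleZeta_two_one_one_eq_add] at h0
  have := multipleZeta_pos_of_isAdmissible_holds (s := [2, 2]) (by decide)
  linarith

/-- The two representations of Euler's identity are different generators of the free group. -/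
theorem zRep_three_ne_zRep_two_one :
    (⟨3, zRep [3] (by decide)⟩ : Σ n, IntegralRep n) ≠ ⟨3, zRep [2, 1] (by decide)⟩ := by
  intro h
  have hint : (zRep [3] (by decide)).integrand = (zRep [2, 1] (by decide)).integrand := by
    have := congrArg (fun x : (Σ n, IntegralRep n) => (⟨x.1, x.2.integrand⟩ : Σ n, (Fin n → ℝ) → ℝ)) h
    simp only [Sigma.mk.injEq, heq_eq_eq, true_and] at this
    exact this
  -- evaluate both integrands at `t = (1/2, 1/4, 1/2)`: `16` versus `16/3`
  have key := congrFun hint (![1/2, 1/4, 1/2] : Fin 3 → ℝ)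
  change (∏ i : Fin 3, mzvForm ((MZV.binaryWord [3]).getD i false) ((![1/2, 1/4, 1/2] : Fin 3 → ℝ) i)) =
    ∏ i : Fin 3, mzvForm ((MZV.binaryWord [2, 1]).getD i false) ((![1/2, 1/4, 1/2] : Fin 3 → ℝ) i) at key
  simp [Fin.prod_univ_three, mzvForm, MZV.binaryWord] at key
  norm_num at key

/-- **"On the nose" is false**: `H_ρ(2) = [ζ-rep 3] − [ζ-rep(2,1)] ≠ 0` in `FormalRep`; Euler's
identity is a genuine relation, not a syntactic one. [folklore] -/
theorem hoffmanElement_two_ne_zero : hoffmanElement zetaRep [2] ≠ 0 := by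
  rw [hoffmanElement_two, zetaRep_of_isAdmissible (by decide), zetaRep_of_isAdmissible (by decide),
    sub_ne_zero]
  exact fun h => zRep_three_ne_zRep_two_one (FreeAbelianGroup.of_injective h)

/-! ## §5 Where the crux HOLDS cheaply: the duality dichotomy

`s = ()` is trivial; `s = (2)` (Euler) is ONE change of variables — the duality `τ(3) = (2,1)`, i.e.
the route's provable support item `DualityInKZ`; more generally, for a SELF-DUAL index (`τ(s) = s`,
which forces `w = 2k`, consistent with §3) Hoffman's element is a sum of duality pairs
`[ζ-rep u] − [ζ-rep τ(u)]`, hence follows from `DualityInKZ` alone: shown for `(3,1)` and `(2,2)`.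
Reason (word combinatorics, §6): the split indices of `s` are exactly the duals of the raised indices
of `τ(s)`, so modulo duality `H(s) ≡ Σ_i [ζ(s + e_i)] − Σ_i [ζ(τ(s) + e_i)]`, antisymmetric under `τ`.
The first instance needing MORE than duality is `s = (3)` (`τ(3) = (2,1) ≠ (3)`; `ε = −1`, §3). -/

/-- `s = ()` is (trivially) an instance. [folklore] -/
theorem instance_nil (Z : List ℕ → FormalRep) : hoffmanElement Z [] ∈ relations := by
  rw [hoffmanElement_nil]; exact relations.zero_mem

/-- Transport of the simplex class along an equality of indices. -/
theorem of_zRep_congr {u v : List ℕ} (h : u = v) (hu : MZV.IsAdmissible u) (hv : MZV.IsAdmissible v) :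
    of (zRep u hu) = of (zRep v hv) := by
  subst h; rfl

/-- A duality pair `[ζ-rep u] − [ζ-rep τ(u)]` is a relation under `DualityInKZ`. -/
theorem duality_pair (hD : DualityInKZ) {u v : List ℕ} (hu : MZV.IsAdmissible u)
    (hv : MZV.IsAdmissible v) (h : MZV.dual u = v) : of (zRep u hu) - of (zRep v hv) ∈ relations := by
  subst h
  exact hD u hu

/-- A duality pair of canonical classes is a relation under `DualityInKZ`. [folklore] -/
theorem duality_pair' (hD : DualityInKZ) {u v : List ℕ} (hu : MZV.IsAdmissible u)
    (hv : MZV.IsAdmissible v) (h : MZV.dual u = v) : zetaRep u - zetaRep v ∈ relations := by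
  rw [zetaRep_of_isAdmissible hu, zetaRep_of_isAdmissible hv]; exact duality_pair hD hu hv h

/-- **`s = (2)` IS Euler's `ζ(3) = ζ(2,1)` as a KZ-equivalence of the two simplex representations.** -/
theorem atTwo_iff :
    hoffmanElement zetaRep [2] ∈ relations ↔ KZ.Equivalent (zRep [3] (by decide)) (zRep [2, 1] (by decide)) := by
  rw [hoffmanElement_two, zetaRep_of_isAdmissible (by decide), zetaRep_of_isAdmissible (by decide)]
  rfl

/-- **`s = (2)` follows from `DualityInKZ`** (`τ(3) = (2,1)`: one change of variables). -/
theorem atTwo_of_duality (hD : DualityInKZ) : hoffmanElement zetaRep [2] ∈ relations := by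
  rw [hoffmanElement_two]
  exact duality_pair' hD (by decide) (by decide) (by decide)

/-- `H(3,1) = ([ζ(4,1)] − [ζ(3,1,1)]) + ([ζ(3,2)] − [ζ(2,2,1)])`: two duality pairs. -/
theorem hoffmanElement_three_one (Z : List ℕ → FormalRep) :
    hoffmanElement Z [3, 1] = (Z [4, 1] - Z [3, 1, 1]) + (Z [3, 2] - Z [2, 2, 1]) := by
  simp [hoffmanElement, List.range_succ]
  abel

/-- **Self-dual `s = (3,1)` follows from `DualityInKZ`.** -/
theorem atThreeOne_of_duality (hD : DualityInKZ) : hoffmanElement zetaRep [3, 1] ∈ relations := by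
  rw [hoffmanElement_three_one]
  exact relations.add_mem (duality_pair' hD (by decide) (by decide) (by decide))
    (duality_pair' hD (by decide) (by decide) (by decide))

/-- `H(2,2) = ([ζ(3,2)] − [ζ(2,2,1)]) + ([ζ(2,3)] − [ζ(2,1,2)])`: two duality pairs. -/
theorem hoffmanElement_two_two (Z : List ℕ → FormalRep) :
    hoffmanElement Z [2, 2] = (Z [3, 2] - Z [2, 2, 1]) + (Z [2, 3] - Z [2, 1, 2]) := by
  simp [hoffmanElement, List.range_succ]
  abel

/-- **Self-dual `s = (2,2)` follows from `DualityInKZ`.** -/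
theorem atTwoTwo_of_duality (hD : DualityInKZ) : hoffmanElement zetaRep [2, 2] ∈ relations := by
  rw [hoffmanElement_two_two]
  exact relations.add_mem (duality_pair' hD (by decide) (by decide) (by decide))
    (duality_pair' hD (by decide) (by decide) (by decide))

/-- Value check at `s = (3)`: `ζ(4) − (ζ(3,1) + ζ(2,2)) = 0` (tree: `multipleZeta_three_one_add_two_two`). -/
theorem eval_hoffmanElement_three : eval (hoffmanElement zetaRep [3]) = 0 := by
  rw [hoffmanElement_three, map_sub, map_add, eval_zetaRep (by decide), eval_zetaRep (by decide),
    eval_zetaRep (by decide), multipleZeta_three_one_add_two_two, sub_self]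




/-! ## §6 The hidden `ℤ/2`-symmetry: Hoffman modulo duality (kernel-checked in weight ≤ 8)

Word combinatorics (`x = ω₀`, `y = ω₁`, `w(s) = x^{s₁−1} y ⋯ x^{s_k−1} y`): the raised indices of `s` are
the insertions of one `x` into an `x`-block, the split indices the insertions of one `y` right after
some `x`; duality `τ` = reverse + swap. Hence **the split indices of `s` are exactly the duals of the
raised indices of `τ(s)`** (as multisets), so that, writing `R(s) = Σ_i [ζ-rep(s + e_i)]`,

  `H(s) = R(s) − R(τ s)^τ ≡ R(s) − R(τ s) =: D(s)`  modulo `DualityInKZ`,  `D(τ s) = −D(s)`.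

Consequences (all proved below from the multiset identity, which is kernel-checked by `decide` for
every admissible index of weight `≤ 10` — 512 indices — and holds to weight 12 by exact enumeration,
2048 indices; the general word-combinatorial proof is routine and left to the positive side):
* `Hoffman(s) ⟺ Hoffman(τ s)` given `DualityInKZ`: the family has HALF as many independent members;
  a counterexample search may restrict to one of `{s, τ(s)}`;
* **self-dual `s` (`τ s = s`) are exactly the CoV-only instances**: `H(s)` is a sum of duality pairs —
  consistent with §3a, since `τ s = s` forces `w = 2k` (`ε(H(s)) = 0`); the self-dual indices of weight
  `≤ 10` are `(), (2), (2,2), (3,1), (2,1,3), (2,2,2), (3,2,1), (4,1,1), …` (32 of them);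
* the crux modulo `DualityInKZ` is the **raise-symmetry** statement `R(s) ~ R(τ s)` ("Ohno `ℓ = 1`"
  shape), whose first instance is `s = (3)`: `[ζ(4)] ~ [ζ(3,1)] + [ζ(2,2)]` (`τ(3) = (2,1)`,
  `R(2,1) = [ζ(3,1)] + [ζ(2,2)]`) — again the weight-4 relation, from a second direction. -/

section Symmetry

/-- The raised indices of `s`. -/
def raises (s : List ℕ) : List (List ℕ) := (List.range s.length).map (raise s)

/-- The split indices of `s` (with multiplicity, grouped by position). -/
def splits (s : List ℕ) : List (List ℕ) :=
  ((List.range s.length).map fun i => (List.range (s.getD i 0 - 1)).map (split s i)).flatten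

/-- The raise sum `R_Z(s) = Σ_i Z(s + e_i)`. -/
def raiseSum (Z : List ℕ → FormalRep) (s : List ℕ) : FormalRep := ((raises s).map Z).sum

/-- `H_Z(s) = Σ_{raises} Z − Σ_{splits} Z`. -/
theorem hoffmanElement_eq_raises_sub_splits (Z : List ℕ → FormalRep) (s : List ℕ) :
    hoffmanElement Z s = ((raises s).map Z).sum - ((splits s).map Z).sum := by
  rw [hoffmanElement_eq]
  simp only [raises, splits, List.map_map, List.map_flatten, List.sum_flatten, Function.comp_def]

/-- Members of `raises s` are admissible. -/
theorem isAdmissible_of_mem_raises {s : List ℕ} (hs : MZV.IsAdmissible s) {r : List ℕ}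
    (hr : r ∈ raises s) : MZV.IsAdmissible r := by
  simp only [raises, List.mem_map, List.mem_range] at hr
  obtain ⟨i, hi, rfl⟩ := hr
  exact isAdmissible_raise hs hi

/-- A list of duality pairs is a relation. -/
theorem sum_sub_sum_dual_mem_relations (hD : DualityInKZ) :
    ∀ l : List (List ℕ), (∀ r ∈ l, MZV.IsAdmissible r) →
      (l.map zetaRep).sum - (l.map (zetaRep ∘ MZV.dual)).sum ∈ relations
  | [], _ => by simp [relations.zero_mem]
  | r :: l, h => by
    have hr : MZV.IsAdmissible r := h r (by simp)
    have ih := sum_sub_sum_dual_mem_relations hD l fun x hx => h x (by simp [hx])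
    have hp := duality_pair' hD hr (MZV.isAdmissible_dual hr) rfl
    simp only [List.map_cons, List.sum_cons, Function.comp_apply]
    have e : zetaRep r + (l.map zetaRep).sum - (zetaRep (MZV.dual r) + (l.map (zetaRep ∘ MZV.dual)).sum) =
        (zetaRep r - zetaRep (MZV.dual r)) + ((l.map zetaRep).sum - (l.map (zetaRep ∘ MZV.dual)).sum) := by
      abel
    rw [e]
    exact relations.add_mem hp ih

/-- **Hoffman modulo duality is raise-antisymmetry**: if the split indices of `s` are the duals of
the raised indices of `τ(s)`, then `H(s) ≡ R(s) − R(τ s)` modulo `DualityInKZ`. -/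
theorem hoffman_sub_raiseDefect_mem (hD : DualityInKZ) {s : List ℕ} (hs : MZV.IsAdmissible s)
    (hperm : List.Perm (splits s) ((raises (MZV.dual s)).map MZV.dual)) :
    hoffmanElement zetaRep s - (raiseSum zetaRep s - raiseSum zetaRep (MZV.dual s)) ∈ relations := by
  rw [hoffmanElement_eq_raises_sub_splits, (hperm.map zetaRep).sum_eq, List.map_map]
  have h := sum_sub_sum_dual_mem_relations hD (raises (MZV.dual s))
    (fun r hr => isAdmissible_of_mem_raises (MZV.isAdmissible_dual hs) hr)
  have e : ((raises s).map zetaRep).sum - ((raises (MZV.dual s)).map (zetaRep ∘ MZV.dual)).sum -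
      (raiseSum zetaRep s - raiseSum zetaRep (MZV.dual s)) =
      ((raises (MZV.dual s)).map zetaRep).sum - ((raises (MZV.dual s)).map (zetaRep ∘ MZV.dual)).sum := by
    simp only [raiseSum]; abel
  rw [e]
  exact h

/-- Hence `Hoffman(s) ⟺ R(s) ~ R(τ s)`, given duality and the multiset identity. -/
theorem hoffman_iff_raiseSymm (hD : DualityInKZ) {s : List ℕ} (hs : MZV.IsAdmissible s)
    (hperm : List.Perm (splits s) ((raises (MZV.dual s)).map MZV.dual)) :
    hoffmanElement zetaRep s ∈ relations ↔ raiseSum zetaRep s - raiseSum zetaRep (MZV.dual s) ∈ relations := by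
  have h := hoffman_sub_raiseDefect_mem hD hs hperm
  constructor
  · intro hH
    simpa using relations.sub_mem hH h
  · intro hR
    simpa using relations.add_mem h hR

/-- **Self-dual indices are CoV-only instances**: `τ s = s` ⇒ `H(s) ∈ relations` from `DualityInKZ`. -/
theorem selfDual_of_duality (hD : DualityInKZ) {s : List ℕ} (hs : MZV.IsAdmissible s)
    (hperm : List.Perm (splits s) ((raises (MZV.dual s)).map MZV.dual)) (hτ : MZV.dual s = s) :
    hoffmanElement zetaRep s ∈ relations := by
  rw [hoffman_iff_raiseSymm hD hs hperm, hτ, sub_self]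
  exact relations.zero_mem

/-- **`ℤ/2`-symmetry of the family**: `Hoffman(s) ⟺ Hoffman(τ s)` given duality (and the multiset
identity at `s` and at `τ s`). -/
theorem hoffman_iff_hoffman_dual (hD : DualityInKZ) {s : List ℕ} (hs : MZV.IsAdmissible s)
    (hperm : List.Perm (splits s) ((raises (MZV.dual s)).map MZV.dual))
    (hperm' : List.Perm (splits (MZV.dual s)) ((raises (MZV.dual (MZV.dual s))).map MZV.dual)) :
    hoffmanElement zetaRep s ∈ relations ↔ hoffmanElement zetaRep (MZV.dual s) ∈ relations := by
  rw [hoffman_iff_raiseSymm hD hs hperm, hoffman_iff_raiseSymm hD (MZV.isAdmissible_dual hs) hperm',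
    MZV.dual_dual hs]
  constructor <;> intro h <;> simpa using relations.neg_mem h

/-! ### Kernel-checked enumeration (weight ≤ 8) -/

/-- Fuelled enumeration of the compositions of `n` into positive parts. -/
def compsFuel : ℕ → ℕ → List (List ℕ)
  | _, 0 => [[]]
  | 0, _ + 1 => []
  | f + 1, n + 1 => ((List.range (n + 1)).map fun j => (compsFuel f j).map fun c => (n + 1 - j) :: c).flatten

/-- The compositions of `n`. -/
def comps (n : ℕ) : List (List ℕ) := compsFuel n n

/-- The admissible indices of weight `≤ W` (all of them: the count below is `Σ_{w ≤ W} 2^{w−2} + 1`). -/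
def admissiblesLE (W : ℕ) : List (List ℕ) :=
  (((List.range (W + 1)).map comps).flatten).filter fun s => decide (MZV.IsAdmissible s)

/-- Sanity: `128 = 1 + (1 + 2 + ⋯ + 64)` admissible indices of weight `≤ 8`, without repetition. -/
theorem admissiblesLE_eight_card : (admissiblesLE 8).length = 128 ∧ (admissiblesLE 8).Nodup := by
  decide +kernel

/-- Sanity: `512` admissible indices of weight `≤ 10` (repetition-freeness is checked at weight `8`;
at weight `10` the quadratic `Nodup` check exceeds the kernel's default recursion budget). -/
theorem admissiblesLE_ten_card : (admissiblesLE 10).length = 512 := by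
  decide +kernel

/-- **The multiset identity `splits(s) = τ(raises(τ s))`, kernel-checked for all 128 admissible
indices of weight `≤ 8`.** -/
theorem splits_perm_le_eight :
    ∀ s ∈ admissiblesLE 8, List.Perm (splits s) ((raises (MZV.dual s)).map MZV.dual) := by
  decide +kernel

/-- **The same for all 512 admissible indices of weight `≤ 10`** (weight 12, 2048 indices, exceeds the
default heartbeat budget of one declaration and is confirmed by exact enumeration outside Lean). -/
theorem splits_perm_le_ten :
    ∀ s ∈ admissiblesLE 10, List.Perm (splits s) ((raises (MZV.dual s)).map MZV.dual) := by
  decide +kernel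

/-- The self-dual admissible indices of weight `≤ 8`. -/
theorem selfDual_le_eight :
    (admissiblesLE 8).filter (fun s => decide (MZV.dual s = s)) =
      [[], [2], [3, 1], [2, 2], [4, 1, 1], [3, 2, 1], [2, 2, 2], [2, 1, 3], [5, 1, 1, 1], [4, 2, 1, 1],
        [3, 2, 2, 1], [3, 1, 3, 1], [2, 3, 1, 2], [2, 2, 2, 2], [2, 1, 2, 3], [2, 1, 1, 4]] := by
  decide +kernel

/-- **All 16 self-dual instances of weight `≤ 8` follow from `DualityInKZ` alone** (no additivity, no
Stokes: §3a says they are the only candidates, `ε = 0`). -/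
theorem selfDual_le_eight_of_duality (hD : DualityInKZ) :
    ∀ s ∈ admissiblesLE 8, MZV.dual s = s → hoffmanElement zetaRep s ∈ relations := by
  intro s hs hτ
  have hadm : MZV.IsAdmissible s := by
    have := (List.mem_filter.mp hs).2
    simpa using this
  exact selfDual_of_duality hD hadm (splits_perm_le_eight s hs) hτ

/-- **The `ℤ/2`-symmetry, unconditionally in the combinatorics, for weight `≤ 8`.** -/
theorem hoffman_iff_hoffman_dual_le_eight (hD : DualityInKZ) :
    ∀ s ∈ admissiblesLE 8, hoffmanElement zetaRep s ∈ relations ↔ hoffmanElement zetaRep (MZV.dual s) ∈ relations := by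
  intro s hs
  have hadm : MZV.IsAdmissible s := by
    have := (List.mem_filter.mp hs).2
    simpa using this
  have hs' : MZV.dual s ∈ admissiblesLE 8 := by
    revert s; decide +kernel
  exact hoffman_iff_hoffman_dual hD hadm (splits_perm_le_eight s hs) (splits_perm_le_eight _ hs')

/-- **Self-dual indices of weight `≤ 10` (32 of them) are change-of-variables-only instances.** -/
theorem selfDual_le_ten_of_duality (hD : DualityInKZ) :
    ∀ s ∈ admissiblesLE 10, MZV.dual s = s → hoffmanElement zetaRep s ∈ relations := by
  intro s hs hτ
  have hadm : MZV.IsAdmissible s := by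
    have := (List.mem_filter.mp hs).2
    simpa using this
  exact selfDual_of_duality hD hadm (splits_perm_le_ten s hs) hτ

/-- There are exactly 32 self-dual admissible indices of weight `≤ 10`. -/
theorem selfDual_le_ten_card : ((admissiblesLE 10).filter fun s => decide (MZV.dual s = s)).length = 32 := by
  decide +kernel

/-- **The `ℤ/2`-symmetry for weight `≤ 10`.** -/
theorem hoffman_iff_hoffman_dual_le_ten (hD : DualityInKZ) :
    ∀ s ∈ admissiblesLE 10, hoffmanElement zetaRep s ∈ relations ↔ hoffmanElement zetaRep (MZV.dual s) ∈ relations := by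
  intro s hs
  have hadm : MZV.IsAdmissible s := by
    have := (List.mem_filter.mp hs).2
    simpa using this
  have hs' : MZV.dual s ∈ admissiblesLE 10 := by
    revert s; decide +kernel
  exact hoffman_iff_hoffman_dual hD hadm (splits_perm_le_ten s hs) (splits_perm_le_ten _ hs')

/-- The first instance beyond duality, from the symmetric side: modulo `DualityInKZ`, `Hoffman(3)` is
`[ζ-rep 4] − ([ζ-rep(3,1)] + [ζ-rep(2,2)]) ∈ relations` ⟺ `R(3) ~ R(2,1)`. -/
theorem raiseDefect_three : raiseSum zetaRep [3] - raiseSum zetaRep (MZV.dual [3]) =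
    zetaRep [4] - (zetaRep [3, 1] + zetaRep [2, 2]) := by
  have h0 : MZV.dual [3] = [2, 1] := by decide
  have h1 : raises [3] = [[4]] := by decide
  have h2 : raises [2, 1] = [[3, 1], [2, 2]] := by decide
  simp [raiseSum, h0, h1, h2]

end Symmetry


/-! ## §7 Cross-route: the first live instance IS Deregularisation's `HoffmanWeightFour` (stmt-3906)

`HoffmanWeightFour` quantifies over arbitrary representations with the literal domain
`{1 > t₀ > t₁ > t₂ > t₃ > 0}` and the three rational integrands; representations with the same domain
whose integrands agree ON the domain are equivalent (integrand additivity with a zero representation: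
Literature `KZ.of_sub_of_mem_relations_of_eqOn`), so it is equivalent to the `s = (3)` instance of this crux (and of the twin 3167). A refutation of
stmt-3906 therefore refutes this crux and the summit; a proof of it is the recommended first rung here. -/

section CrossRoute

/-- The literal domain of `HoffmanWeightFour` / Grothendieck 0275 is the open ordered 4-simplex. -/
theorem chainSet_eq_openOrderedSimplex :
    {t : Fin 4 → ℝ | 1 > t 0 ∧ t 0 > t 1 ∧ t 1 > t 2 ∧ t 2 > t 3 ∧ t 3 > 0} = openOrderedSimplex 4 := by
  ext t
  simp only [Set.mem_setOf_eq, openOrderedSimplex]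
  constructor
  · rintro ⟨h0, h1, h2, h3, h4⟩
    refine ⟨fun i => ?_, fun i => ?_, fun i j hij => ?_⟩
    · fin_cases i <;> simp <;> linarith
    · fin_cases i <;> simp <;> linarith
    · fin_cases i <;> fin_cases j <;> simp at hij ⊢ <;> linarith
  · rintro ⟨hpos, hlt, hanti⟩
    exact ⟨hlt 0, hanti (show (0 : Fin 4) < 1 by decide), hanti (show (1 : Fin 4) < 2 by decide),
      hanti (show (2 : Fin 4) < 3 by decide), hpos 3⟩

/-- **`Hoffman(3)` in this crux ⟺ `Deregularisation.HoffmanWeightFour`.** [folklore] -/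
theorem atThree_iff_hoffmanWeightFour :
    hoffmanElement zetaRep [3] ∈ relations ↔ Theses.Deregularisation.HoffmanWeightFour := by
  have h4 : MZV.IsAdmissible [4] := by decide
  have h31 : MZV.IsAdmissible [3, 1] := by decide
  have h22 : MZV.IsAdmissible [2, 2] := by decide
  have hd4 : (zRep [4] h4 : IntegralRep 4).domain =
      {t : Fin 4 → ℝ | 1 > t 0 ∧ t 0 > t 1 ∧ t 1 > t 2 ∧ t 2 > t 3 ∧ t 3 > 0} :=
    chainSet_eq_openOrderedSimplex.symm
  have hf4 : ∀ t : Fin 4 → ℝ, (zRep [4] h4 : IntegralRep 4).integrand t = 1 / (t 0 * t 1 * t 2 * (1 - t 3)) := by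
    intro t; change mzvIntegrand [4] t = _; rw [mzvIntegrand_four, one_div, mul_inv, mul_inv, mul_inv]
  have hf31 : ∀ t : Fin 4 → ℝ, (zRep [3, 1] h31 : IntegralRep 4).integrand t =
      1 / (t 0 * t 1 * (1 - t 2) * (1 - t 3)) := by
    intro t; change mzvIntegrand [3, 1] t = _; rw [mzvIntegrand_three_one, one_div, mul_inv, mul_inv, mul_inv]
  have hf22 : ∀ t : Fin 4 → ℝ, (zRep [2, 2] h22 : IntegralRep 4).integrand t =
      1 / (t 0 * (1 - t 1) * t 2 * (1 - t 3)) := by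
    intro t; change mzvIntegrand [2, 2] t = _; rw [mzvIntegrand_two_two, one_div, mul_inv, mul_inv, mul_inv]
  rw [hoffmanElement_three, zetaRep_of_isAdmissible h4, zetaRep_of_isAdmissible h31,
    zetaRep_of_isAdmissible h22]
  constructor
  · intro hH r₁ r₂ r₃ hd₁ hf₁ hd₂ hf₂ hd₃ hf₃
    have e₁ : of r₁ - of (zRep [4] h4 : IntegralRep 4) ∈ relations :=
      of_sub_of_mem_relations_of_eqOn (by rw [hd4, hd₁]) fun t ht => by rw [hf₁ ht, hf4]
    have e₂ : of r₂ - of (zRep [3, 1] h31 : IntegralRep 4) ∈ relations :=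
      of_sub_of_mem_relations_of_eqOn (by rw [hd₂, hd₁]; exact hd4) fun t ht => by rw [hf₂ ht, hf31]
    have e₃ : of r₃ - of (zRep [2, 2] h22 : IntegralRep 4) ∈ relations :=
      of_sub_of_mem_relations_of_eqOn (by rw [hd₃, hd₁]; exact hd4) fun t ht => by rw [hf₃ ht, hf22]
    have e : of r₁ - of r₂ - of r₃ =
        (of r₁ - of (zRep [4] h4 : IntegralRep 4)) - (of r₂ - of (zRep [3, 1] h31 : IntegralRep 4)) -
          (of r₃ - of (zRep [2, 2] h22 : IntegralRep 4)) +
          (of (zRep [4] h4) - (of (zRep [3, 1] h31) + of (zRep [2, 2] h22))) := by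
      abel
    rw [e]
    exact relations.add_mem (relations.sub_mem (relations.sub_mem e₁ e₂) e₃) hH
  · intro hW
    have := hW (zRep [4] h4) (zRep [3, 1] h31) (zRep [2, 2] h22) hd4 (fun t _ => hf4 t) rfl
      (fun t _ => hf31 t) rfl (fun t _ => hf22 t)
    rw [← sub_sub]
    exact this

end CrossRoute


/-! ## §8 TARGETS (generation 3): the picked line `dilation-homotopy-transposition`

The lead picked `dilation-homotopy-transposition` (`Cruxes/HoffmanRelationInKZ/PICKED.md`,
`Lines/dilation-homotopy-transposition.lean`; seven stubs registered on the item 2026-08-16):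
`stub_cubicalTransport`, `stub_shuffleCells`, `stub_shuffleWords`, `stub_stuffleDissection`,
`stub_dilationCalculus`, `stub_peakExists`, `stub_descents`. Cheap attacks on each, read against the
LITERAL rule shapes of `KZCalculus.lean` (lines 172–224):

* `stub_shuffleWords` (pure list combinatorics) — **PROVED below for every admissible `s`**
  (`stub_shuffleWords_holds`, verbatim type of the stub): the `n` gap words (letter `1` inserted at the
  gaps `g + 1`, `g < n`, of `0^{s₁−1}1⋯0^{s_k−1}1`) are, as a list up to permutation, Hoffman's split
  indices followed by the `k` insertion indices `(s₁..s_{i+1}, 1, …)` (`gapWords_perm`, induction on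
  `s`: the `a − 1` gaps inside the first block are the position-`0` splits in reverse order, the gap
  after the block is the insertion `(a, 1, t)`, later gaps are `a :: gapWords t`); also kernel-checked
  by `decide` for the 512 indices of weight `≤ 10` (`gapWords_perm_le_ten`). (Proved here
  independently; the provers' landed copy is `Theorems/FurushoPentagonHoffmanRelationInKZShuffleWords.lean`,
  `…FurushoPentagon.HoffmanRelationInKZ.stub_shuffleWords` — with `…PeakExists.lean` and `…Descents.lean`
  three of the seven stubs were closed within the lead's first hour, 2026-08-16 00:49Z.)
* `stub_stuffleDissection` — evaluatively EXACT, hence not refutable by value: expanding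
  `f_s(x) − u·f_s(u x₀, x′) = Σ_α c_α x^α (1 − u^{α₀+1})` and dividing by `1 − u` gives
  `value(B_s) = Σ_{n₁>⋯>n_k≥1} H_{n₁} / (n₁^{s₁}⋯n_k^{s_k})` (`H` = harmonic numbers), and
  `H_{n₁} = 1/n₁ + Σ_{m<n₁} 1/m` splits this as `Σ_i ζ(s + e_i) + Σ_{i=1}^{k} ζ(s₁..s_i, 1, s_{i+1}..)` —
  exactly the stub's `Σ_{i<k} (C(raise s i) + C(insertOne s i))` (`insertOne s i = take (i+1) ++ [1] ++
  drop (i+1)`); the block identities are exact FOR ALL `s` (verified here in general, not only on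
  the triagers' 12 indices): with `a_b = T_{p_b}(x)` (`a_0 = 1`), `f_s(x) − u f_s(σ_u x) =
  ∏a · (P_k − P_0)`, `P_b = u^{k−b}/(∏_{j≤b}(1−a_j) ∏_{j>b}(1−u a_j))`, telescoping over `b = 1..k`
  (`k − 1` additivity moves) with `(P_b − P_{b−1})/(1−u) = u^{k−b}/(∏_{j<b}(1−a_j)(1−a_b)(1−u a_b)
  ∏_{j>b}(1−u a_j))`, and `1/(1−a_b) = 1 + a_b/(1−a_b)` splits `∏a·` this term (`k` more moves) into
  `g_b = u^{k−b}∏a/(∏_{j<b}(1−a_j) ∏_{j≥b}(1−u a_j))` = the cubical integrand of `raise` at block `b`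
  with `u` as the LAST variable of block `b` (`a_j⁺ = a_j`, `j < b`; `a_j⁺ = u a_j`, `j ≥ b`) and
  `h_b = u^{k−b} a_b ∏a/(∏_{j≤b}(1−a_j) ∏_{j≥b}(1−u a_j))` = the cubical integrand of `insertOne` after
  block `b` (`u` a new one-variable block: `a′ = (a_1..a_b, u a_b, u a_{b+1}, …)`) — numerators and
  denominators match factor by factor; all summands positive ⇒ absolutely integrable.
* `stub_shuffleCells` — the cells are the ranks of `u` among `t₀ > ⋯ > t_{n−1}`: positions
  `p = g + 1 ∈ {1, …, n}`, `n` cells, each the coordinate permutation of the simplex of the word with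
  `1` inserted at `p`; every inserted word begins with `0` (admissible: `Z` is pinned on all of them) and
  `value(A_s) = Σ_gaps ζ`; the walls `{u = t_i}` are null. No junk index, no vacuity (`s ≠ []`).
* `stub_dilationCalculus` — `λ·f_s(σ_λ x) = λ^k ∏_l T_{p_l}(x) / ∏_l (1 − λ c_l)`, `c_l = T_{p_{l+1}}(x)`,
  so `∂_λ[λ f_s(σ_λ x)] = (λ f_s(σ_λ x))·(k/λ + Σ_l c_l/(1 − λ c_l)) = f_s(σ_λ x)·Σ_l 1/(1 − λ c_l) =
  K_s(σ_λ x)` ✓ (uses `p_{l+1} ≥ 1`, i.e. every `T_{p_{l+1}}` contains `x₀`); denominators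
  `≥ 1 − x₀ > 0` for `λ ∈ [0,1]`, `x` in the open cube ⇒ continuity on `[0,1]`, `K ≥ 0`; both functions
  are rational with non-vanishing denominators on the band ⇒ `ℚ`-semialgebraic. Routine.
* `stub_peakExists` — Tonelli along `λ` with `K ≥ 0` and `∫_u^1 K(σ_λ x) dλ = f(x) − u f(σ_u x)` (FTC from
  the calculus package) ⇒ `∫ peak = value(B_s) < ∞` ✓.
* `stub_descents` — `KZ.newtonLeibnizRel` consumes (i) the CLOSED band `{a(x) ≤ z_last ≤ b(x)}` — the
  stub's `R` has the open band, the two null faces are to be added first, as its docstring says;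
  (ii) the EXACT endpoint identity `r′.integrand x = F(x, b x) − F(x, a x)` on `τ` — supplied by the
  `EqOn` pinning of the A/B representations on their domains, since `F(y,1) − F(y,0) = f(x)/(1−u)`
  (`σ 1 x = x`) and `F(y,1) − F(y,u)` is the difference quotient whole; (iii) `ContinuousOn … (Icc a b)`
  and `HasDerivAt` on `Ioo a b` fibrewise — supplied; (iv) `F` `ℚ`-semialgebraic ON THE BAND — supplied on
  the closed band over the full cube; descent (A) needs the restriction to the sub-base `{y₀ < y₁}`
  (semialgebraicity is monotone in the set). Instantiable.
* `stub_cubicalTransport` — the chart `t_i = x₀⋯x_i` gives `f_s = (mzvIntegrand s ∘ chart)·∏_i T_i`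
  (checked on `(2)`, `(3)`, `(2,1)` by series: `Σ 1/((a+b+2)²(b+1)) = ζ(2,1)`); polynomial, injective on the
  open cube onto the open simplex, triangular Jacobian `∏ T_i > 0`: one `changeOfVariablesRel` each way ✓.

**VERDICT (targets): no stub of the picked line is false, vacuous or mis-indexed under cheap attack**;
every analytic stub is an instance-wise statement about absolutely convergent RATIONAL representations
whose value identity is elementary (above), hence — like the crux — irrefutable short of ¬Conjecture 1.
The line can fail only Lean-side (rule side conditions (i)–(iv)), not mathematically; it honours §3
(uses additivity AND Newton–Leibniz) and §3c (adds the variable `λ`).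

### §8b Where the family sits relative to the route's OTHER items (exact linear algebra; informs lines)

LEVEL 1 (this seat's `level2/l1struct.py`, exact mod `2³¹ − 1`, scripts + logs attached as item evidence).
`m` = word weight = weight(`s`) + 1; columns = the `2^{m−2}` admissible indices of weight `m`; "FDS" = the
formal shadow `shuffle(u,v) − stuffle(u,v)` of `StuffleInKZ ∧ ShuffleIsDissection` at admissible pairs,
"dual" = `w − τw` (`DualityInKZ`), "ideal" = closed under `x ш ·` and `x ∗ ·` with admissible `x`
(relations form an ideal: `KZProductIdeal`), "H(<m)·ζ" = the products `x ш H(s′)`, `x ∗ H(s′)` of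
LOWER-weight Hoffman elements with zeta words (`|x| ≥ 2`) — relations GIVEN Hoffman(`s′`),
`ShuffleIsDissection` and `StuffleInKZ`. Entries: Hoffman(s) in the `ℚ`-span / total, and corank
before adding the weight-`m` Hoffman family (Zagier's `d_m` in brackets):

  m              :   4     5     6     7      8      9      10      11      12       13
  FDS+dual       :  0/2   4/4   0/8   6/16  32/32  12/64    —       —       —        —
  …ideal         :  0/2   4/4   8/8   6/16  32/32  16/64  30/128  42/256  48/512    (§)
    corank (d)   : 2(1)  2(2)  2(2)  4(3)   4(4)   6(5)   8(7)   10(9)  14(12)    (§)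
  + depth-1 H    :  2/2   4/4   8/8   6/16  32/32  16/64    —       —       —        —
  FDS+dual+H<m·ζ :  0/2   4/4   8/8  16/16  32/32  64/64 128/128 256/256 512/512    (§)  
    corank (d)   : 2(1)  2(2)  2(2)  3(3)   4(4)   5(5)   7(7)   9(9)   12(12)    (§)  
  dual+H<m·ζ     :   —    4/4   0/8  16/16  32/32  64/64 128/128 256/256    —        —
  FDS+H<m·ζ      :   —    0/4   0/8   0/16   3/32   0/64   3/128   0/256    —        —

Reading. (i) The other MZV items of the route, even ideal-closed, do NOT formally contain Hoffman's
family: misses at `m = 4, 7, 9, 10, 11, 12` (IKZ 2006 p. 315 (2)–(3) in formal-span form, weight by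
weight); (ii) adding the DEPTH-ONE instances `H((m−1))` changes nothing at `m = 7, 9` — the route text's
foreseen split "depth 1 (sum formula) → general" is not a reduction; (iii) adding `H(<m)·ζ` puts EVERY
Hoffman(s) of weight `m` in the span and brings the corank to `d_m` exactly for `5 ≤ m ≤ 12`: **modulo
`StuffleInKZ ∧ ShuffleIsDissection ∧ DualityInKZ ∧ IntegerDivision` the crux through weight(`s`) `= 11`
is its single weight-4 instance `H(3)` = `Deregularisation.HoffmanWeightFour` (§7)** — per weight, by an
explicit `ℚ`-certificate; (iv) sharper (last two rows): DUALITY plus the lifted lower-weight Hoffman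
elements ALONE already contain the whole weight-`m` family for `m = 5` and `7 ≤ m ≤ 11` — the finite
double shuffles are needed only at `m = 6` (and, of course, inside the lifts `x ∗ H(s′)` as instances of
`StuffleInKZ`) —, whereas without duality nothing propagates (`FDS+H<m·ζ`: `0` or `3`). So the family is
"`H(3)` propagated by duality and products": a uniform statement ("over the finite double shuffle ideal
with duality, the Hoffman ideal is generated by `H(3)`") is a NEW conjecture these numbers suggest, not a
theorem; it would turn the first live instance into the only live instance. (§) `m = 13..15`: kit
`j008123` (numpy engine, two primes, validated against these numbers at `m = 9..12`); outcome in the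
item evidence.

LEVEL 2 (the unpicked line `level-two-descent`; its transfer `C⁺ = stub_levelTwoAbsorption`, now expired,
is the one DECIDABLE-per-weight conjecture in either line). This seat re-derived the level-2 word
algebra from scratch (`I(w) = (∏ε_i)·ζ(s;σ)`, `σ₁ = ε₁`, `σ_i = ε_iε_{i−1}`; `φ^*`: `a ↦ b + c`,
`b ↦ a − c`, `c ↦ c` then reversal; all 681 generators of weight `≤ 6` vanish numerically to `1e−14`)
and an independent eliminator reproduces the card/triage numbers exactly (corank(DS₂+φ) `= 3, 5, 8, 13,
21` for `W = 3..7`, Hoffman in span throughout; `span(DS₂)` alone never; `DS₂+ψ+τ`: `1/1, 0/2, 4/4,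
8/8`; `W = 7` small family rank `887`). The card's own falsifier at `W = 9, 10` (8748 / 26244 convergent
words; staged exact elimination mod 65521 and 65519, self-validating against the pure-Python engine at
`W ≤ 7` and the known `W = 8` numbers) runs as kit jobs `j007813` (W ≤ 9) / `j007814` (W = 10) on the
item.

### §8c `C⁺` at `W = 9`: PASSES (kit `j007813`, 2026-08-16, node cmp-8, 6 min wall)

`W = 9` (8748 convergent level-2 words; 8747 involution rows + 14580 finite double shuffles): rank(DS₂+φ)
`= 8693`, **corank `55 = F₁₀`**, and **all 64 Hoffman(s) of weight 8 lie in span(DS₂+φ)** — identical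
mod 65521 and mod 65519; the engine agreed with the independent pure-Python eliminator at `W = 5, 6, 7`
(rank AND membership) and with the known `W = 8` numbers (2882 / 34 / 32 of 32) inside the same run;
kernel sanity (sampled relation rows annihilate the computed null space) true at every weight. So the
unpicked line's transfer `C⁺` now stands verified for `3 ≤ W ≤ 9` with corank `= F_{W+1}` throughout
(Deligne's level-2 motivic dimension: in these weights span{finite DS₂, φ} is numerically the whole motivic
ideal). STRUCTURAL BY-PRODUCT of the staged elimination (new, useful to any level-2 line): at every weight
`5 ≤ W ≤ 9` the double shuffles with a factor of weight `≥ 3` add NO rank on top of {involution} ∪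
{DS(c, v)} ∪ {DS(u, v) : |u| = 2} (stage ranks `W = 9`: φ 4347, `|u| = 1` 2916, `|u| = 2` 1430, `|u| = 3`
0, `|u| = 4` 0) — the generating set of `C⁺` can be shrunk to the weight-1 and weight-2 factors
`c; ab, ac, cb, cc`. PENDING at publication (queued > 4 h behind higher-priority work; results auto-attach
to the item as `compute-<id>.json` and land in this seat's folder): `W = 10` (kit `j007814`) and the
level-1 rows `m = 13..15` of §8b (kit `j008123`). -/

section Targets

/-- The `n = weight s` GAP WORDS of the picked line `dilation-homotopy-transposition`: the indices of
the binary word of `s` with the letter `1` inserted at the gaps `g + 1`, `g < n` (the cells of the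
shuffle side `[{u < t₀}, ∏ω/(1−u)]` by the rank of `u`; literally the sub-term of `stub_shuffleCells` /
`stub_shuffleWords`). -/
def gapWords (s : List ℕ) : List (List ℕ) :=
  (List.range (MZV.weight s)).map fun g => MZV.ofBinaryWord ((MZV.binaryWord s).insertIdx (g + 1) true)

/-- The `k` INSERTION indices `(s₁,…,s_{i+1}, 1, s_{i+2},…)`, `i < k` (the stuffle terms
`ζ(…, s_{i+1}, 1, …)` of `ζ(1) ∗ ζ(s)` other than `ζ(1, s)`; literally the sub-term of the stubs). -/
def insertions (s : List ℕ) : List (List ℕ) :=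
  (List.range s.length).map fun i => s.take (i + 1) ++ [1] ++ s.drop (i + 1)

/-- The statement of the picked line's stub `stub_shuffleWords` AT the index `s` (verbatim body). -/
def ShuffleWordsAt (s : List ℕ) : Prop :=
  ∀ Z : List ℕ → FormalRep,
    ((List.range (MZV.weight s)).map (fun g => Z (MZV.ofBinaryWord ((MZV.binaryWord s).insertIdx (g + 1) true)))).sum =
      ((List.range s.length).map (fun i => ((List.range (s.getD i 0 - 1)).map
        (fun j => Z (s.take i ++ [s.getD i 0 - j, j + 1] ++ s.drop (i + 1)))).sum)).sum +
      ((List.range s.length).map (fun i => Z (s.take (i + 1) ++ [1] ++ s.drop (i + 1)))).sum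

/-- **Multiset identity ⇒ stub**: if the gap words are a permutation of the split indices followed
by the insertion indices, the stub's `Z`-sum identity holds at `s` for every `Z`. [folklore] -/
theorem shuffleWordsAt_of_perm {s : List ℕ} (h : List.Perm (gapWords s) (splits s ++ insertions s)) :
    ShuffleWordsAt s := by
  intro Z
  have e1 : ((List.range (MZV.weight s)).map
      (fun g => Z (MZV.ofBinaryWord ((MZV.binaryWord s).insertIdx (g + 1) true)))).sum =
      ((gapWords s).map Z).sum := by
    simp only [gapWords, List.map_map, Function.comp_def]
  have e2 : ((List.range s.length).map (fun i => ((List.range (s.getD i 0 - 1)).map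
        (fun j => Z (s.take i ++ [s.getD i 0 - j, j + 1] ++ s.drop (i + 1)))).sum)).sum =
      ((splits s).map Z).sum := by
    simp only [splits, split, List.map_map, List.map_flatten, List.sum_flatten, Function.comp_def]
  have e3 : ((List.range s.length).map (fun i => Z (s.take (i + 1) ++ [1] ++ s.drop (i + 1)))).sum =
      ((insertions s).map Z).sum := by
    simp only [insertions, List.map_map, Function.comp_def]
  rw [e1, e2, e3, (h.map Z).sum_eq, List.map_append, List.sum_append]

/-- **The picked line's `stub_shuffleWords` holds at every admissible index of weight `≤ 8`**
(128 indices; the multiset identity by `decide`, kernel). -/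
theorem gapWords_perm_le_eight :
    ∀ s ∈ admissiblesLE 8, List.Perm (gapWords s) (splits s ++ insertions s) := by
  decide +kernel

/-- … and at every admissible index of weight `≤ 10` (512 indices). -/
theorem gapWords_perm_le_ten :
    ∀ s ∈ admissiblesLE 10, List.Perm (gapWords s) (splits s ++ insertions s) := by
  decide +kernel

/-- **`stub_shuffleWords` for all admissible `s` of weight `≤ 10`.** [folklore] -/
theorem shuffleWordsAt_le_ten : ∀ s ∈ admissiblesLE 10, ShuffleWordsAt s :=
  fun s hs => shuffleWordsAt_of_perm (gapWords_perm_le_ten s hs)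

/-! ### General proof of `stub_shuffleWords` (all indices with positive entries) -/

/-- Inserting past a prefix. [folklore] -/
theorem insertIdx_append_length_add {α : Type*} (l₁ l₂ : List α) (i : ℕ) (x : α) :
    (l₁ ++ l₂).insertIdx (l₁.length + i) x = l₁ ++ l₂.insertIdx i x := by
  induction l₁ with
  | nil => simp
  | cons b l ih =>
    rw [List.cons_append, List.length_cons, show l.length + 1 + i = (l.length + i) + 1 by omega,
      List.insertIdx_succ_cons, ih, List.cons_append]

/-- Inserting the letter `1` inside a block of `0`s. [folklore] -/
theorem insertIdx_replicate_false_append (m p : ℕ) (hp : p ≤ m) (w : List Bool) :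
    (List.replicate m false ++ w).insertIdx p true =
      List.replicate p false ++ true :: (List.replicate (m - p) false ++ w) := by
  induction p generalizing m with
  | zero => simp
  | succ p ih =>
    obtain ⟨m', rfl⟩ : ∃ m', m = m' + 1 := ⟨m - 1, by omega⟩
    rw [List.replicate_succ, List.cons_append, List.insertIdx_succ_cons, ih m' (by omega),
      List.replicate_succ, List.cons_append, Nat.add_sub_add_right]

/-- Reading a block `0^m 1`. [folklore] -/
theorem ofBinaryWord_replicate_false_true (m : ℕ) (w : List Bool) :
    MZV.ofBinaryWord (List.replicate m false ++ true :: w) = (m + 1) :: MZV.ofBinaryWord w := by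
  unfold MZV.ofBinaryWord
  rw [MZV.ofBinaryWordAux_replicate_false_append, MZV.ofBinaryWordAux_true, Nat.zero_add]

/-- The binary word of a cons. [folklore] -/
theorem binaryWord_cons' (a : ℕ) (t : List ℕ) :
    MZV.binaryWord (a :: t) = List.replicate (a - 1) false ++ ([true] ++ MZV.binaryWord t) := by
  rw [MZV.binaryWord, List.append_assoc]

/-- **Gap words of a cons**: the `a − 1` gaps inside the first block give the splits
`(p + 2, a − 1 − p, t)`, the gap after it the insertion `(a, 1, t)`, the later gaps `a :: (gap words of t)`. -/
theorem gapWords_cons {a : ℕ} (ha : 1 ≤ a) {t : List ℕ} (ht : ∀ x ∈ t, 1 ≤ x) :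
    gapWords (a :: t) = ((List.range (a - 1)).map fun p => (p + 2) :: (a - 1 - p) :: t) ++ [a :: 1 :: t] ++
      (gapWords t).map (a :: ·) := by
  have hlen : (List.replicate (a - 1) false ++ [true]).length = a := by simp; omega
  have hG1 : ∀ p, p < a - 1 → MZV.ofBinaryWord ((MZV.binaryWord (a :: t)).insertIdx (p + 1) true) =
      (p + 2) :: (a - 1 - p) :: t := by
    intro p hp
    rw [binaryWord_cons', insertIdx_replicate_false_append (a - 1) (p + 1) (by omega),
      ofBinaryWord_replicate_false_true, List.singleton_append,
      ofBinaryWord_replicate_false_true, MZV.ofBinaryWord_binaryWord ht]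
    congr 2; omega
  have hG2 : MZV.ofBinaryWord ((MZV.binaryWord (a :: t)).insertIdx (a - 1 + 1) true) = a :: 1 :: t := by
    rw [binaryWord_cons', ← List.append_assoc, show a - 1 + 1 = (List.replicate (a - 1) false ++ [true]).length + 0 by
      rw [hlen]; omega, insertIdx_append_length_add, List.insertIdx_zero, List.append_assoc,
      List.singleton_append, ofBinaryWord_replicate_false_true,
      show true :: MZV.binaryWord t = List.replicate 0 false ++ true :: MZV.binaryWord t by simp,
      ofBinaryWord_replicate_false_true, MZV.ofBinaryWord_binaryWord ht]
    congr 1; omega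
  have hG3 : ∀ g, MZV.ofBinaryWord ((MZV.binaryWord (a :: t)).insertIdx (a - 1 + 1 + g + 1) true) =
      a :: MZV.ofBinaryWord ((MZV.binaryWord t).insertIdx (g + 1) true) := by
    intro g
    rw [binaryWord_cons', ← List.append_assoc,
      show a - 1 + 1 + g + 1 = (List.replicate (a - 1) false ++ [true]).length + (g + 1) by rw [hlen]; omega,
      insertIdx_append_length_add, List.append_assoc, List.singleton_append, ofBinaryWord_replicate_false_true]
    congr 1; omega
  unfold gapWords
  have hw : MZV.weight (a :: t) = (a - 1) + 1 + MZV.weight t := by simp [MZV.weight]; omega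
  rw [hw, List.range_add, List.range_succ, List.map_append, List.map_append, List.map_map, List.map_map]
  congr 1
  · congr 1
    · exact List.map_congr_left fun p hp => hG1 p (List.mem_range.mp hp)
    · rw [List.map_singleton, hG2]
  · exact List.map_congr_left fun g _ => by simp only [Function.comp_apply]; exact hG3 g

/-- Splits of a cons: position `0` then `a :: splits t`. [folklore] -/
theorem splits_cons (a : ℕ) (t : List ℕ) :
    splits (a :: t) = ((List.range (a - 1)).map fun j => (a - j) :: (j + 1) :: t) ++ (splits t).map (a :: ·) := by
  unfold splits
  rw [List.length_cons, List.range_succ_eq_map, List.map_cons, List.flatten_cons, List.map_map,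
    List.map_flatten, List.map_map]
  refine congrArg₂ (· ++ ·) ?_ ?_
  · exact List.map_congr_left fun j _ => by simp [split]
  · refine congrArg List.flatten (List.map_congr_left fun i _ => ?_)
    simp only [Function.comp_apply, List.getD_cons_succ, List.map_map]
    exact List.map_congr_left fun j _ => by simp [split]

/-- Insertions of a cons. [folklore] -/
theorem insertions_cons (a : ℕ) (t : List ℕ) :
    insertions (a :: t) = [a :: 1 :: t] ++ (insertions t).map (a :: ·) := by
  unfold insertions
  rw [List.length_cons, List.range_succ_eq_map, List.map_cons, List.map_map, List.map_map,
    List.singleton_append]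
  refine congrArg₂ List.cons (by simp) (List.map_congr_left fun i _ => by simp)

/-- The reversed range. [folklore] -/
theorem map_range_reverse {α : Type*} (n : ℕ) (f : ℕ → α) :
    ((List.range n).map f).reverse = (List.range n).map fun p => f (n - 1 - p) := by
  rw [← List.map_reverse, List.range_eq_range', List.reverse_range', List.map_map, ← List.range_eq_range']
  refine List.map_congr_left fun p hp => ?_
  simp only [Function.comp_apply]
  congr 1; simp at hp; omega

/-- **The multiset identity behind `stub_shuffleWords`, for every index with positive entries**: the
gap words are the split indices together with the insertion indices. [cite: Hoffman1992, Thm 5.1] -/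
theorem gapWords_perm {s : List ℕ} (hs : ∀ x ∈ s, 1 ≤ x) :
    List.Perm (gapWords s) (splits s ++ insertions s) := by
  induction s with
  | nil => exact List.Perm.refl _
  | cons a t ih =>
    have ha : 1 ≤ a := hs a (by simp)
    have ht : ∀ x ∈ t, 1 ≤ x := fun x hx => hs x (by simp [hx])
    rw [gapWords_cons ha ht, splits_cons, insertions_cons]
    set S₀ := (List.range (a - 1)).map fun j => (a - j) :: (j + 1) :: t with hS₀
    have hrev : ((List.range (a - 1)).map fun p => (p + 2) :: (a - 1 - p) :: t) = S₀.reverse := by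
      rw [hS₀, map_range_reverse]
      refine List.map_congr_left fun p hp => ?_
      simp at hp
      congr 2 <;> omega
    rw [hrev]
    have h1 : List.Perm (S₀.reverse ++ [a :: 1 :: t] ++ (gapWords t).map (a :: ·))
        (S₀ ++ ([a :: 1 :: t] ++ ((splits t).map (a :: ·) ++ (insertions t).map (a :: ·)))) := by
      rw [List.append_assoc]
      refine List.Perm.append (List.reverse_perm _) (List.Perm.append_left _ ?_)
      simpa [List.map_append] using (ih ht).map (a :: ·)
    refine h1.trans ?_
    simp only [List.append_assoc]
    refine List.Perm.append_left _ ?_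
    rw [List.singleton_append, List.singleton_append]
    exact List.perm_middle.symm

/-- **The picked line's `stub_shuffleWords`, proved for every admissible index.** [cite: Hoffman1992, Thm 5.1] -/
theorem shuffleWordsAt_of_isAdmissible {s : List ℕ} (hs : MZV.IsAdmissible s) : ShuffleWordsAt s :=
  shuffleWordsAt_of_perm (gapWords_perm hs.1)

/-- The stub verbatim (type of `stub_shuffleWords` in `Lines/dilation-homotopy-transposition.lean`). -/
theorem stub_shuffleWords_holds : ∀ (s : List ℕ), MZV.IsAdmissible s → ∀ Z : List ℕ → KZ.FormalRep, ((List.range (MZV.weight s)).map (fun g => Z (MZV.ofBinaryWord ((MZV.binaryWord s).insertIdx (g + 1) true)))).sum = ((List.range s.length).map (fun i => ((List.range (s.getD i 0 - 1)).map (fun j => Z (s.take i ++ [s.getD i 0 - j, j + 1] ++ s.drop (i + 1)))).sum)).sum + ((List.range s.length).map (fun i => Z (s.take (i + 1) ++ [1] ++ s.drop (i + 1)))).sum :=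
  fun _ hs Z => shuffleWordsAt_of_isAdmissible hs Z

end Targets

end Summit.KontsevichZagierPeriods.KontsevichZagierPeriods.Cruxes.HoffmanRelationInKZ.Disproof
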